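import Literature.Combinatorics.Optimization.ShellLawGeneratingPolynomial
import HarnessLib

/-!
# The population mixture: for a block with no `HH` edge, the level-`c` shell law is a
# `Bin(c,½)`-mixture of level-`0` (hypergeometric) laws of the SAME ground set

Cell pnp-psdrank (literature seat g36; eng g23's MEMO-22 rev 2 §6 (K1), item (L-K1) of the proposed typing
split). Fix a fixed-point-free involution `π` (a perfect matching), a `π`-stable ground set `S` of `N` edges
(`|S| = 2N`) and a block `H` such that NO edge of `S` has both endpoints in `H` (type `(0,b,d)`: `b` mixed
edges, `d` edges disjoint from `H`; `vAA_S(H) = ∅`). A cut `U ∈ Shell_S(2s+c,c)` consists of `s` full edges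
and `c` half-matched vertices; the block statistic is `X = |U ∩ H|`.

* **`shellCount_eq_sum_levelZero`** (K1, count form) — for all `s, c` and `y ∈ ℤ`:
  `Sh_S(2s+c, c; y) = Σ_{w ≤ c} C(N−s−w, c−w)·C(s+w, w)·Sh_S(2(s+w), 0; y)`;
* **`card_shellIn_eq_choose`** — `|Shell_S(2s+c,c)| = C(N,s)·C(N−s,c)·2^c` (the case `H = ∅` of (K1));
* **`shellLaw_eq_binomialMixture_levelZero`** (K1, law form) — for `s + c ≤ N`:
  `law_S(2s+c, c; y) = Σ_{w ≤ c} C(c,w)·2^{−c}·law_S(2(s+w), 0; y)`: the realised vertex scores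
  (full edge → its `H`-weight, half vertex → a fair coin on a mixed edge, `0` on an empty one) make `X`
  conditionally hypergeometric given the "population" `K = s + Bin(c,½)` (eng's phrasing);
* **`shellLaw_odd_eq_binomialProfile`** — the same in the currency of eng g23's `BinomialSmoothingProfile`
  ((L-K2), p667776): `law_S(2s₀+1, 2j+1; y) = Σ_{w ≤ 2j+1} C(2j+1,w)·2^{−(2j+1)}·φ(s₀−j+w)`, `φ(K) = law_S(2K,0;y)`;
* **`shellCount_eq_sum_split_vAA`** (K0, §7) — for ANY type: `Sh_S(t,c;y) = Σ_{t₁ ≤ t, c₁ ≤ c} |Shell_{AA}(t₁,c₁)|·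
  Sh_{S∖AA}(t−t₁, c−c₁; y−t₁)` (`AA` = the `HH` class; `S ∖ AA` has type `(0,b,d)`, where (K1) applies;
  `card_shellIn_split_class` = class splitting at every level, `half_inter_class`, `sdiff_vAA_noHH`);
* **`shellCount_zero_eq_coeff_hyperGen`**, **`shellLaw_zero_eq`** — the level-`0` laws of a type-`(0,b,d)`
  ground set are hypergeometric: `Sh_S(2r,0;y) = C(b,y)·C(d,r−y) = coeff_y H_{b,d,r}` and
  `law_S(2r,0;y) = coeff_y H_{b,d,r}/C(N,r)` (`N = b + d`), i.e. eng's `Hyp_N(r; b)(y) = C(r,y)C(N−r,b−y)/C(N,b)`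
  by the hypergeometric symmetry;
* (v2, §8 (LP)) **`shellCount_eq_sum_split_touch`**, **`shellLaw_eq_sum_touch_descFactorial`** /
  **`…_descPochhammer`** — the touch-class split: at fixed cut size the shell law of ANY block is one pattern
  polynomial of degree `≤ a + b` in the level;
* (v3, §9 (K0-law)) **`shellCount_eq_sum_split_hh`**, **`shellLaw_eq_sum_split_hh_descFactorial`** (and the
  `f ≤ s, g ≤ c`-ranged form `…'`) — the `HH`-class split in the pattern `(f, g)` = (full, half) `HH` edges:
  `law_S(2s+c,c;y) = Σ_{f ≤ a} Σ_{g ≤ a−f} C(a,f)C(a−f,g)(s)_f(c)_g(N−s−c)_{a−f−g}/(N)_a · law_{S∖AA}(2(s−f)+(c−g), c−g; y−(2f+g))`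
  (multivariate-hypergeometric pattern weights, polynomial of degree `a` in the level at fixed cut size;
  `card_inter_class_eq`).

Proof of (K1) (the coin argument as two bijections on cuts; no generating functions): ORIENT every edge of
`S` so that its TAIL lies outside `H` — possible exactly because no edge is `HH`: the head of a mixed edge is
its `H`-endpoint, the head of an empty edge its smaller endpoint (`§1`: an abstract orientation is a decidable
predicate `hd` with `hd v ↔ ¬hd (πv)` and `¬hd v → v ∉ H` on `S`; heads and tails are equinumerous, `§1`).
(A) `card_filter_headCount_eq` — stripping the `c − w` TAIL half-vertices of `U` is a bijection onto
(cuts `V ∈ Shell_S(2s+w, w)` all of whose half-vertices are heads) × ((c−w)-subsets of the `N − s − w` tails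
of the edges untouched by `V`), and `|U ∩ H| = |V ∩ H|`; (B) `card_filter_allHead_eq` — closing the `w` head
half-vertices of such a `V` into full edges is a bijection onto (`G ∈ Shell_S(2(s+w), 0)`) × (`w`-subsets of
the `s + w` tails of `G`), and `|V ∩ H| = |G ∩ H|`. Summing over the head count `w ≤ c` of `half(U)` gives
(K1); at `H = ∅` every vertex is a tail candidate and (K1) counts the shell; dividing gives the law form via
`C(N−s−w,c−w)·C(s+w,w)·C(N,s+w) = C(N,s)·C(N−s,c)·C(c,w)`.

All PROVED, 0 sorry, no definitions, no named facts. Companion items of the split (not here): (L-K2) the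
binomial-operator identities `Δ^k_j law_{2j+1} = 4^{−k}·E[(∇²_K)^k Hyp(·)(y)](K₁)` for an arbitrary kernel and
(L-K4) far-root difference bounds (eng g23); (T-K) the small-block virtual positivity brick (prover). Instrument/support material for the OPEN crux
`TracialDecayExp20` — nothing here is a statement about that crux, about psd rank, or about P vs NP.

## References
* [Rothvoss2017] T. Rothvoß, *The matching polytope has exponential extension complexity*, J. ACM 64
  (2017), §2 (PDF pp. 5–6): cuts `U`, the partition of `δ(U) ∩ M`, the level classes `Q_c`.
* [VatutinMikhailov1983] V. A. Vatutin, V. G. Mikhailov, *Limit theorems for the number of empty cells in an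
  equiprobable scheme for group allocation of particles*, Theory Probab. Appl. 27 (1983) 734–743, §2
  (the hypergeometric law as a law of a subset count).
* [ChattamvelliShanmugam2020] R. Chattamvelli, R. Shanmugam, *Discrete Distributions in Engineering and the
  Applied Sciences* (2020), §7.1–7.4 (the hypergeometric law, its two parametrisations and their symmetry).
-/

noncomputable section

open Finset Polynomial

namespace Literature.Combinatorics.Optimization

namespace ShellStep

open Literature.Combinatorics.StablePolynomials (hyperGen coeff_hyperGen)

variable {n : ℕ} {π : Fin n → Fin n}

section Orientation

variable (hπ : ∀ v, π (π v) = v) (hπ' : ∀ v, π v ≠ v)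
include hπ hπ'

/-! ### §1 Orientations: one head and one tail per edge -/

omit hπ' in
/-- **Heads and tails are equinumerous.** If `hd` is an orientation of the `π`-stable set `C` (exactly one
endpoint of each edge is a head), then `C` has `|C|/2` tails. [cite: Rothvoss2017, §2 (PDF p. 5)] -/
theorem two_mul_card_filter_not_head {C : Finset (Fin n)} (hC : ∀ v ∈ C, π v ∈ C) (hd : Fin n → Prop)
    [DecidablePred hd] (hflip : ∀ v ∈ C, hd v ↔ ¬ hd (π v)) :
    2 * (C.filter fun v => ¬ hd v).card = C.card := by
  classical
  have hinj : Function.Injective π := fun a b h => by rw [← hπ a, ← hπ b, h]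
  have himg : (C.filter fun v => hd v).image π = C.filter fun v => ¬ hd v := by
    ext w
    simp only [mem_image, mem_filter]
    constructor
    · rintro ⟨v, ⟨hvC, hv⟩, rfl⟩
      exact ⟨hC v hvC, (hflip v hvC).1 hv⟩
    · rintro ⟨hwC, hw⟩
      refine ⟨π w, ⟨hC w hwC, ?_⟩, hπ w⟩
      have h' := hflip (π w) (hC w hwC)
      rw [hπ] at h'
      exact h'.2 hw
  have hcard : (C.filter fun v => hd v).card = (C.filter fun v => ¬ hd v).card := by
    rw [← himg, card_image_of_injective _ hinj]
  have hsum := card_filter_add_card_filter_not (s := C) (fun v => hd v)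
  omega

omit hπ hπ' in
/-- **The orientation of a block with no `HH` edge**: head = the `H`-endpoint of a mixed edge, the smaller
endpoint of an edge disjoint from `H`. On a `π`-stable `S` with no `HH` edge this is an orientation
(`hd v ↔ ¬hd (πv)`) whose tails lie outside `H`. [cite: Rothvoss2017, §2 (PDF p. 5)] -/
theorem blockOrientation_spec (hπ : ∀ v, π (π v) = v) (hπ' : ∀ v, π v ≠ v) {S H : Finset (Fin n)}
    (hA : ∀ v ∈ S, ¬ (v ∈ H ∧ π v ∈ H)) :
    (∀ v ∈ S, (v ∈ H ∨ (π v ∉ H ∧ v < π v)) ↔ ¬ (π v ∈ H ∨ (π (π v) ∉ H ∧ π v < π (π v)))) ∧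
      (∀ v ∈ S, ¬ (v ∈ H ∨ (π v ∉ H ∧ v < π v)) → v ∉ H) := by
  refine ⟨fun v hv => ?_, fun v _ h hvH => h (Or.inl hvH)⟩
  rw [hπ]
  have hne : v ≠ π v := (hπ' v).symm
  have hA' := hA v hv
  rcases lt_or_gt_of_ne hne with hlt | hgt
  · constructor
    · rintro (hvH | ⟨hπvH, _⟩)
      · rintro (hπvH | ⟨_, h⟩)
        · exact hA' ⟨hvH, hπvH⟩
        · exact lt_asymm hlt h
      · rintro (h | ⟨_, h⟩)
        · exact hπvH h
        · exact lt_asymm hlt h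
    · intro h
      by_cases hvH : v ∈ H
      · exact Or.inl hvH
      · right
        exact ⟨fun hπvH => h (Or.inl hπvH), hlt⟩
  · constructor
    · rintro (hvH | ⟨_, h⟩)
      · rintro (hπvH | ⟨hvH', _⟩)
        · exact hA' ⟨hvH, hπvH⟩
        · exact hvH' hvH
      · exact absurd h (lt_asymm hgt)
    · intro h
      by_cases hvH : v ∈ H
      · exact Or.inl hvH
      · exfalso
        apply h
        by_cases hπvH : π v ∈ H
        · exact Or.inl hπvH
        · exact Or.inr ⟨hvH, hgt⟩

omit hπ hπ' in
/-- No `HH` edge in terms of the type count: `|reps(vAA_S(H))| = 0` iff no `v ∈ S` has `v, πv ∈ H`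
(for `π`-stable `S`). [cite: Rothvoss2017, §2 (PDF p. 5)] -/
theorem noHH_of_card_reps_vAA_eq_zero (hπ : ∀ v, π (π v) = v) (hπ' : ∀ v, π v ≠ v) {S : Finset (Fin n)}
    (hS : ∀ v ∈ S, π v ∈ S) (H : Finset (Fin n)) (h0 : (reps π (vAA π S H)).card = 0) :
    ∀ v ∈ S, ¬ (v ∈ H ∧ π v ∈ H) := by
  intro v hv ⟨hvH, hπvH⟩
  have hst := vAA_stable hπ S H hS
  have h2 := two_mul_card_reps hπ hπ' hst
  rw [h0, mul_zero] at h2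
  have : v ∈ vAA π S H := mem_vAA.2 ⟨hv, hvH, hπvH⟩
  rw [eq_comm, card_eq_zero] at h2
  rw [h2] at this
  exact notMem_empty v this

/-! ### §2 Bijection (B): closing the head half-vertices into full edges -/

omit hπ' in
/-- **(B)** For an orientation `hd` of the `π`-stable `S` with tails outside `H`: the cuts
`V ∈ Shell_S(2s+w, w)` all of whose `w` half-vertices are HEADS, with `|V ∩ H| = y`, are in bijection with
the pairs (`G ∈ Shell_S(2(s+w), 0)` with `|G ∩ H| = y`, a `w`-subset `E` of the `s+w` TAILS of `G`) via
`V ↦ (V ∪ π(half V), π(half V))`, `(G,E) ↦ G ∖ E`; hence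
`#{V} = C(s+w, w) · Sh_S(2(s+w), 0; y)`. [cite: Rothvoss2017, §2 (PDF p. 6)] -/
theorem card_filter_allHead_eq {S : Finset (Fin n)} (hS : ∀ v ∈ S, π v ∈ S) (H : Finset (Fin n))
    (hd : Fin n → Prop) [DecidablePred hd] (hflip : ∀ v ∈ S, hd v ↔ ¬ hd (π v))
    (htail : ∀ v ∈ S, ¬ hd v → v ∉ H) (s w : ℕ) (y : ℤ) :
    ((shellIn π S (2 * s + w) w).filter fun V => (∀ v ∈ half π V, hd v) ∧ ((V ∩ H).card : ℤ) = y).card =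
      (s + w).choose w * ((shellIn π S (2 * (s + w)) 0).filter fun G => ((G ∩ H).card : ℤ) = y).card := by
  classical
  have hinj : Function.Injective π := fun a b h => by rw [← hπ a, ← hπ b, h]
  -- the target as a sigma set and its cardinality
  have hB : (((shellIn π S (2 * (s + w)) 0).filter fun G => ((G ∩ H).card : ℤ) = y).sigma
      fun G => powersetCard w (G.filter fun v => ¬ hd v)).card =
      (s + w).choose w * ((shellIn π S (2 * (s + w)) 0).filter fun G => ((G ∩ H).card : ℤ) = y).card := by
    rw [card_sigma, sum_const_nat (m := (s + w).choose w), mul_comm]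
    intro G hG
    obtain ⟨hGS, hGcard, hGst⟩ := mem_shellIn_zero.1 (mem_filter.1 hG).1
    have h2 := two_mul_card_filter_not_head hπ hGst hd fun v hv => hflip v (hGS hv)
    rw [card_powersetCard]
    congr 1
    omega
  rw [← hB]
  refine card_nbij' (fun V => ⟨V ∪ (half π V).image π, (half π V).image π⟩) (fun GE => GE.1 \ GE.2)
    ?_ ?_ ?_ ?_
  · -- (i) maps into the target
    intro V hV
    simp only [mem_coe, mem_filter, mem_shellIn] at hV
    obtain ⟨⟨hVS, hVcard, hVhalf⟩, hheads, hVy⟩ := hV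
    have hdisj : Disjoint V ((half π V).image π) := by
      rw [disjoint_left]
      rintro v hvV hvim
      obtain ⟨u, hu, rfl⟩ := mem_image.1 hvim
      exact (mem_half.1 hu).2 hvV
    have hEcard : ((half π V).image π).card = w := by rw [card_image_of_injective _ hinj, hVhalf]
    have htl : ∀ u ∈ half π V, ¬ hd (π u) := fun u hu =>
      (hflip u (hVS ((half_subset (π := π) V) hu))).1 (hheads u hu)
    simp only [mem_coe, mem_sigma, mem_filter, mem_shellIn_zero, mem_powersetCard]
    refine ⟨⟨⟨?_, ?_, ?_⟩, ?_⟩, ?_, hEcard⟩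
    · intro v hv
      rcases mem_union.1 hv with h | h
      · exact hVS h
      · obtain ⟨u, hu, rfl⟩ := mem_image.1 h
        exact hS u (hVS ((half_subset (π := π) V) hu))
    · rw [card_union_of_disjoint hdisj, hVcard, hEcard]; ring
    · intro v hv
      rcases mem_union.1 hv with h | h
      · by_cases hπv : π v ∈ V
        · exact mem_union.2 (Or.inl hπv)
        · exact mem_union.2 (Or.inr (mem_image.2 ⟨v, mem_half.2 ⟨h, hπv⟩, rfl⟩))
      · obtain ⟨u, hu, rfl⟩ := mem_image.1 h
        rw [hπ]
        exact mem_union.2 (Or.inl ((half_subset (π := π) V) hu))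
    · have : (V ∪ (half π V).image π) ∩ H = V ∩ H := by
        ext v
        simp only [mem_inter, mem_union, mem_image]
        constructor
        · rintro ⟨h | ⟨u, hu, rfl⟩, hvH⟩
          · exact ⟨h, hvH⟩
          · exact absurd hvH (htail (π u) (hS u (hVS ((half_subset (π := π) V) hu))) (htl u hu))
        · rintro ⟨h, hvH⟩
          exact ⟨Or.inl h, hvH⟩
      rw [this]; exact hVy
    · intro e he
      obtain ⟨u, hu, rfl⟩ := mem_image.1 he
      exact mem_filter.2 ⟨mem_union.2 (Or.inr he), htl u hu⟩
  · -- (j) maps back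
    rintro ⟨G, E⟩ hGE
    simp only [mem_coe, mem_sigma, mem_filter, mem_shellIn_zero, mem_powersetCard] at hGE
    obtain ⟨⟨⟨hGS, hGcard, hGst⟩, hGy⟩, hEsub, hEcard⟩ := hGE
    have hEG : E ⊆ G := fun e he => (mem_filter.1 (hEsub he)).1
    have hEtail : ∀ e ∈ E, ¬ hd e := fun e he => (mem_filter.1 (hEsub he)).2
    have hπEhd : ∀ e ∈ E, hd (π e) := fun e he => by
      by_contra h
      exact hEtail e he ((hflip e (hGS (hEG he))).2 h)
    have hπE : ∀ e ∈ E, π e ∉ E := fun e he h => hEtail (π e) h (hπEhd e he)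
    have hhalf : half π (G \ E) = E.image π := by
      ext v
      simp only [mem_half, mem_sdiff, mem_image]
      constructor
      · rintro ⟨⟨hvG, _⟩, hπv⟩
        have hπvE : π v ∈ E := by
          by_contra h
          exact hπv ⟨hGst v hvG, h⟩
        exact ⟨π v, hπvE, hπ v⟩
      · rintro ⟨e, he, rfl⟩
        refine ⟨⟨hGst e (hEG he), hπE e he⟩, ?_⟩
        rw [hπ]
        exact fun h => h.2 he
    simp only [mem_coe, mem_filter, mem_shellIn]
    refine ⟨⟨fun v hv => hGS (mem_sdiff.1 hv).1, ?_, ?_⟩, ?_, ?_⟩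
    · have := card_sdiff_add_card_eq_card hEG
      omega
    · rw [hhalf, card_image_of_injective _ hinj, hEcard]
    · rw [hhalf]
      intro v hv
      obtain ⟨e, he, rfl⟩ := mem_image.1 hv
      exact hπEhd e he
    · have : (G \ E) ∩ H = G ∩ H := by
        ext v
        simp only [mem_inter, mem_sdiff]
        constructor
        · rintro ⟨⟨hvG, _⟩, hvH⟩; exact ⟨hvG, hvH⟩
        · rintro ⟨hvG, hvH⟩
          exact ⟨⟨hvG, fun hvE => htail v (hGS hvG) (hEtail v hvE) hvH⟩, hvH⟩
      rw [this]; exact hGy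
  · -- left inverse
    intro V hV
    simp only [mem_coe, mem_filter, mem_shellIn] at hV
    have hdisj : Disjoint V ((half π V).image π) := by
      rw [disjoint_left]
      rintro v hvV hvim
      obtain ⟨u, hu, rfl⟩ := mem_image.1 hvim
      exact (mem_half.1 hu).2 hvV
    show (V ∪ (half π V).image π) \ (half π V).image π = V
    exact union_sdiff_cancel_right hdisj
  · -- right inverse
    rintro ⟨G, E⟩ hGE
    simp only [mem_coe, mem_sigma, mem_filter, mem_shellIn_zero, mem_powersetCard] at hGE
    obtain ⟨⟨⟨hGS, _, hGst⟩, _⟩, hEsub, _⟩ := hGE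
    have hEG : E ⊆ G := fun e he => (mem_filter.1 (hEsub he)).1
    have hEtail : ∀ e ∈ E, ¬ hd e := fun e he => (mem_filter.1 (hEsub he)).2
    have hπEhd : ∀ e ∈ E, hd (π e) := fun e he => by
      by_contra h
      exact hEtail e he ((hflip e (hGS (hEG he))).2 h)
    have hπE : ∀ e ∈ E, π e ∉ E := fun e he h => hEtail (π e) h (hπEhd e he)
    have hhalf : half π (G \ E) = E.image π := by
      ext v
      simp only [mem_half, mem_sdiff, mem_image]
      constructor
      · rintro ⟨⟨hvG, _⟩, hπv⟩
        have hπvE : π v ∈ E := by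
          by_contra h
          exact hπv ⟨hGst v hvG, h⟩
        exact ⟨π v, hπvE, hπ v⟩
      · rintro ⟨e, he, rfl⟩
        refine ⟨⟨hGst e (hEG he), hπE e he⟩, ?_⟩
        rw [hπ]
        exact fun h => h.2 he
    have himg : (E.image π).image π = E := by
      rw [image_image]
      have : π ∘ π = id := funext hπ
      rw [this, image_id]
    show (⟨(G \ E) ∪ (half π (G \ E)).image π, (half π (G \ E)).image π⟩ :
        (_ : Finset (Fin n)) × Finset (Fin n)) = ⟨G, E⟩
    rw [hhalf, himg, sdiff_union_of_subset hEG]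

/-! ### §3 Bijection (A): stripping the tail half-vertices -/

omit hπ' in
/-- **(A)** For an orientation `hd` of the `π`-stable `S` (`|S| = 2N`) with tails outside `H`, and `w ≤ c`:
the cuts `U ∈ Shell_S(2s+c, c)` with exactly `w` HEAD half-vertices and `|U ∩ H| = y` are in bijection with
the pairs (`V ∈ Shell_S(2s+w, w)` all of whose half-vertices are heads, `|V ∩ H| = y`; a `(c−w)`-subset `T` of
the `N − s − w` TAILS of the edges untouched by `V`) via `U ↦ (U ∖ tails(half U), tails(half U))`,
`(V,T) ↦ V ∪ T`; hence `#{U} = C(N−s−w, c−w) · #{V}`. [cite: Rothvoss2017, §2 (PDF p. 6)] -/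
theorem card_filter_headCount_eq {S : Finset (Fin n)} (hS : ∀ v ∈ S, π v ∈ S) {N : ℕ} (hN : S.card = 2 * N)
    (H : Finset (Fin n)) (hd : Fin n → Prop) [DecidablePred hd] (hflip : ∀ v ∈ S, hd v ↔ ¬ hd (π v))
    (htail : ∀ v ∈ S, ¬ hd v → v ∉ H) (s c w : ℕ) (hwc : w ≤ c) (y : ℤ) :
    ((shellIn π S (2 * s + c) c).filter fun U =>
        ((half π U).filter fun v => hd v).card = w ∧ ((U ∩ H).card : ℤ) = y).card =
      (N - s - w).choose (c - w) *
        ((shellIn π S (2 * s + w) w).filter fun V => (∀ v ∈ half π V, hd v) ∧ ((V ∩ H).card : ℤ) = y).card := by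
  classical
  have hinj : Function.Injective π := fun a b h => by rw [← hπ a, ← hπ b, h]
  -- the free part of a cut `V` of the all-head shell: `π`-stable with `N − s − w` tails
  have hfree : ∀ V ∈ ((shellIn π S (2 * s + w) w).filter fun V =>
      (∀ v ∈ half π V, hd v) ∧ ((V ∩ H).card : ℤ) = y),
      ((S \ (V ∪ V.image π)).filter fun v => ¬ hd v).card = N - s - w := by
    intro V hV
    simp only [mem_filter, mem_shellIn] at hV
    obtain ⟨⟨hVS, hVcard, hVhalf⟩, _, _⟩ := hV
    -- `V ∪ πV = V ⊔ π(half V)` has `2s + 2w` elements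
    have hcl : V ∪ V.image π = V ∪ (half π V).image π := by
      ext v
      simp only [mem_union, mem_image, mem_half]
      constructor
      · rintro (h | ⟨u, hu, rfl⟩)
        · exact Or.inl h
        · by_cases hπu : π u ∈ V
          · exact Or.inl hπu
          · exact Or.inr ⟨u, ⟨hu, hπu⟩, rfl⟩
      · rintro (h | ⟨u, ⟨hu, _⟩, rfl⟩)
        · exact Or.inl h
        · exact Or.inr ⟨u, hu, rfl⟩
    have hdisj : Disjoint V ((half π V).image π) := by
      rw [disjoint_left]
      rintro v hvV hvim
      obtain ⟨u, hu, rfl⟩ := mem_image.1 hvim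
      exact (mem_half.1 hu).2 hvV
    have hclcard : (V ∪ V.image π).card = 2 * s + 2 * w := by
      rw [hcl, card_union_of_disjoint hdisj, card_image_of_injective _ hinj, hVcard, hVhalf]; ring
    have hclS : V ∪ V.image π ⊆ S := by
      intro v hv
      rcases mem_union.1 hv with h | h
      · exact hVS h
      · obtain ⟨u, hu, rfl⟩ := mem_image.1 h; exact hS u (hVS hu)
    have hCst : ∀ v ∈ S \ (V ∪ V.image π), π v ∈ S \ (V ∪ V.image π) := by
      intro v hv
      obtain ⟨hvS, hvcl⟩ := mem_sdiff.1 hv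
      refine mem_sdiff.2 ⟨hS v hvS, fun h => hvcl ?_⟩
      rcases mem_union.1 h with h' | h'
      · exact mem_union.2 (Or.inr (mem_image.2 ⟨π v, h', hπ v⟩))
      · obtain ⟨u, hu, hu'⟩ := mem_image.1 h'
        have : u = v := hinj hu'
        rw [this] at hu
        exact mem_union.2 (Or.inl hu)
    have h2 := two_mul_card_filter_not_head hπ hCst hd fun v hv => hflip v (mem_sdiff.1 hv).1
    have h3 := card_sdiff_add_card_eq_card hclS
    omega
  -- the target as a sigma set and its cardinality
  have hB : ((((shellIn π S (2 * s + w) w).filter fun V => (∀ v ∈ half π V, hd v) ∧ ((V ∩ H).card : ℤ) = y)).sigma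
      fun V => powersetCard (c - w) ((S \ (V ∪ V.image π)).filter fun v => ¬ hd v)).card =
      (N - s - w).choose (c - w) *
        ((shellIn π S (2 * s + w) w).filter fun V => (∀ v ∈ half π V, hd v) ∧ ((V ∩ H).card : ℤ) = y).card := by
    rw [card_sigma, sum_const_nat (m := (N - s - w).choose (c - w)), mul_comm]
    intro V hV
    rw [card_powersetCard, hfree V hV]
  rw [← hB]
  refine card_nbij' (fun U => ⟨U \ (half π U).filter (fun v => ¬ hd v), (half π U).filter fun v => ¬ hd v⟩)
    (fun VT => VT.1 ∪ VT.2) ?_ ?_ ?_ ?_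
  · -- (i) maps into the target
    intro U hU
    simp only [mem_coe, mem_filter, mem_shellIn] at hU
    obtain ⟨⟨hUS, hUcard, hUhalf⟩, hw, hUy⟩ := hU
    have hTsub : (half π U).filter (fun v => ¬ hd v) ⊆ U :=
      (filter_subset _ _).trans (half_subset (π := π) U)
    have hTcard : ((half π U).filter fun v => ¬ hd v).card = c - w := by
      have := card_filter_add_card_filter_not (s := half π U) (fun v => hd v)
      omega
    have hhalf : half π (U \ (half π U).filter fun v => ¬ hd v) = (half π U).filter fun v => hd v := by
      ext v
      constructor
      · intro hv
        obtain ⟨hvUT, hπv⟩ := mem_half.1 hv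
        obtain ⟨hvU, hvT⟩ := mem_sdiff.1 hvUT
        -- `πv ∉ U`: otherwise `πv` is full in `U`, hence not stripped, hence in `U ∖ T`
        have hπvU : π v ∉ U := fun h => hπv (mem_sdiff.2 ⟨h, fun hT =>
          (mem_half.1 (mem_filter.1 hT).1).2 (by rw [hπ]; exact hvU)⟩)
        have hvhalf : v ∈ half π U := mem_half.2 ⟨hvU, hπvU⟩
        refine mem_filter.2 ⟨hvhalf, ?_⟩
        by_contra h
        exact hvT (mem_filter.2 ⟨hvhalf, h⟩)
      · intro hv
        obtain ⟨hvhalf, hvd⟩ := mem_filter.1 hv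
        obtain ⟨hvU, hπvU⟩ := mem_half.1 hvhalf
        exact mem_half.2 ⟨mem_sdiff.2 ⟨hvU, fun hT => (mem_filter.1 hT).2 hvd⟩,
          fun h => hπvU (mem_sdiff.1 h).1⟩
    simp only [mem_coe, mem_sigma, mem_filter, mem_shellIn, mem_powersetCard]
    refine ⟨⟨⟨fun v hv => hUS (mem_sdiff.1 hv).1, ?_, ?_⟩, ?_, ?_⟩, ?_, hTcard⟩
    · have := card_sdiff_add_card_eq_card hTsub
      omega
    · rw [hhalf, hw]
    · rw [hhalf]
      intro v hv
      exact (mem_filter.1 hv).2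
    · have : (U \ (half π U).filter fun v => ¬ hd v) ∩ H = U ∩ H := by
        ext v
        simp only [mem_inter, mem_sdiff, mem_filter]
        constructor
        · rintro ⟨⟨hvU, _⟩, hvH⟩; exact ⟨hvU, hvH⟩
        · rintro ⟨hvU, hvH⟩
          refine ⟨⟨hvU, fun h => htail v (hUS hvU) h.2 hvH⟩, hvH⟩
      rw [this]; exact hUy
    · intro t ht
      obtain ⟨htU, htd⟩ := mem_filter.1 ht
      obtain ⟨htU', hπt⟩ := mem_half.1 htU
      refine mem_filter.2 ⟨mem_sdiff.2 ⟨hUS htU', fun h => ?_⟩, htd⟩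
      rcases mem_union.1 h with h' | h'
      · exact (mem_sdiff.1 h').2 ht
      · obtain ⟨u, hu, hut⟩ := mem_image.1 h'
        have hu' : u ∈ U := (mem_sdiff.1 hu).1
        have : π t = u := by rw [← hut, hπ]
        exact hπt (this ▸ hu')
  · -- (j) maps back
    rintro ⟨V, T⟩ hVT
    simp only [mem_coe, mem_sigma, mem_filter, mem_shellIn, mem_powersetCard] at hVT
    obtain ⟨⟨⟨hVS, hVcard, hVhalf⟩, hheads, hVy⟩, hTsub, hTcard⟩ := hVT
    have hTS : ∀ t ∈ T, t ∈ S := fun t ht => (mem_sdiff.1 (mem_filter.1 (hTsub ht)).1).1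
    have hTtail : ∀ t ∈ T, ¬ hd t := fun t ht => (mem_filter.1 (hTsub ht)).2
    have hTfree : ∀ t ∈ T, t ∉ V ∧ π t ∉ V := by
      intro t ht
      have h := (mem_sdiff.1 (mem_filter.1 (hTsub ht)).1).2
      rw [mem_union, not_or, mem_image] at h
      exact ⟨h.1, fun h' => h.2 ⟨π t, h', hπ t⟩⟩
    have hdisj : Disjoint V T := disjoint_right.2 fun t ht => (hTfree t ht).1
    have hπT : ∀ t ∈ T, π t ∉ T := fun t ht h => hTtail (π t) h (by
      by_contra h'
      exact hTtail t ht ((hflip t (hTS t ht)).2 h'))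
    have hhalf : half π (V ∪ T) = half π V ∪ T := by
      ext v
      simp only [mem_half, mem_union]
      constructor
      · rintro ⟨hv | hv, hπv⟩
        · exact Or.inl ⟨hv, fun h => hπv (Or.inl h)⟩
        · exact Or.inr hv
      · rintro (⟨hvV, hπvV⟩ | hvT)
        · refine ⟨Or.inl hvV, ?_⟩
          rintro (h | h)
          · exact hπvV h
          · -- `πv ∈ T` is impossible: `v ∈ half V` is a head, `πv` its tail, but the edge of `v` is touched by `V`
            exact (hTfree (π v) h).2 (by rw [hπ]; exact hvV)
        · refine ⟨Or.inr hvT, ?_⟩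
          rintro (h | h)
          · exact (hTfree v hvT).2 h
          · exact hπT v hvT h
    have hdisj' : Disjoint (half π V) T :=
      disjoint_left.2 fun v hv hvT => (hTfree v hvT).1 ((half_subset (π := π) V) hv)
    simp only [mem_coe, mem_filter, mem_shellIn]
    refine ⟨⟨union_subset hVS fun t ht => hTS t ht, ?_, ?_⟩, ?_, ?_⟩
    · rw [card_union_of_disjoint hdisj, hVcard, hTcard]; omega
    · rw [hhalf, card_union_of_disjoint hdisj', hVhalf, hTcard]; omega
    · rw [hhalf, filter_union, filter_true_of_mem hheads, filter_false_of_mem fun t ht => hTtail t ht,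
        union_empty, hVhalf]
    · have : (V ∪ T) ∩ H = V ∩ H := by
        ext v
        simp only [mem_inter, mem_union]
        constructor
        · rintro ⟨hv | hv, hvH⟩
          · exact ⟨hv, hvH⟩
          · exact absurd hvH (htail v (hTS v hv) (hTtail v hv))
        · rintro ⟨hv, hvH⟩; exact ⟨Or.inl hv, hvH⟩
      rw [this]; exact hVy
  · -- left inverse
    intro U hU
    have hTsub : (half π U).filter (fun v => ¬ hd v) ⊆ U :=
      (filter_subset _ _).trans (half_subset (π := π) U)
    show (U \ (half π U).filter fun v => ¬ hd v) ∪ (half π U).filter (fun v => ¬ hd v) = U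
    exact sdiff_union_of_subset hTsub
  · -- right inverse
    rintro ⟨V, T⟩ hVT
    simp only [mem_coe, mem_sigma, mem_filter, mem_shellIn, mem_powersetCard] at hVT
    obtain ⟨⟨⟨hVS, _, _⟩, hheads, _⟩, hTsub, _⟩ := hVT
    have hTS : ∀ t ∈ T, t ∈ S := fun t ht => (mem_sdiff.1 (mem_filter.1 (hTsub ht)).1).1
    have hTtail : ∀ t ∈ T, ¬ hd t := fun t ht => (mem_filter.1 (hTsub ht)).2
    have hTfree : ∀ t ∈ T, t ∉ V ∧ π t ∉ V := by
      intro t ht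
      have h := (mem_sdiff.1 (mem_filter.1 (hTsub ht)).1).2
      rw [mem_union, not_or, mem_image] at h
      exact ⟨h.1, fun h' => h.2 ⟨π t, h', hπ t⟩⟩
    have hdisj : Disjoint V T := disjoint_right.2 fun t ht => (hTfree t ht).1
    have hπT : ∀ t ∈ T, π t ∉ T := fun t ht h => hTtail (π t) h (by
      by_contra h'
      exact hTtail t ht ((hflip t (hTS t ht)).2 h'))
    have hhalf : half π (V ∪ T) = half π V ∪ T := by
      ext v
      simp only [mem_half, mem_union]
      constructor
      · rintro ⟨hv | hv, hπv⟩
        · exact Or.inl ⟨hv, fun h => hπv (Or.inl h)⟩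
        · exact Or.inr hv
      · rintro (⟨hvV, hπvV⟩ | hvT)
        · refine ⟨Or.inl hvV, ?_⟩
          rintro (h | h)
          · exact hπvV h
          · exact (hTfree (π v) h).2 (by rw [hπ]; exact hvV)
        · refine ⟨Or.inr hvT, ?_⟩
          rintro (h | h)
          · exact (hTfree v hvT).2 h
          · exact hπT v hvT h
    have hT : (half π (V ∪ T)).filter (fun v => ¬ hd v) = T := by
      rw [hhalf, filter_union, filter_false_of_mem fun v hv => not_not.2 (hheads v hv),
        filter_true_of_mem fun t ht => hTtail t ht, empty_union]
    show (⟨(V ∪ T) \ (half π (V ∪ T)).filter (fun v => ¬ hd v), (half π (V ∪ T)).filter fun v => ¬ hd v⟩ :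
        (_ : Finset (Fin n)) × Finset (Fin n)) = ⟨V, T⟩
    rw [hT, union_sdiff_cancel_right hdisj]

/-! ### §4 The population mixture (K1): count form -/

omit hπ' in
/-- **(K1), COUNT FORM, for an abstract orientation.** For a `π`-stable `S` with `|S| = 2N`, a block `H`
and an orientation `hd` of `S` with tails outside `H`:
`Sh_S(2s+c, c; y) = Σ_{w ≤ c} C(N−s−w, c−w)·C(s+w, w)·Sh_S(2(s+w), 0; y)` (sum the bijections (A), (B) over
the number `w` of head half-vertices). [cite: Rothvoss2017, §2 (PDF p. 6)] -/
theorem shellCount_eq_sum_levelZero_of_orientation {S : Finset (Fin n)} (hS : ∀ v ∈ S, π v ∈ S) {N : ℕ}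
    (hN : S.card = 2 * N) (H : Finset (Fin n)) (hd : Fin n → Prop) [DecidablePred hd]
    (hflip : ∀ v ∈ S, hd v ↔ ¬ hd (π v)) (htail : ∀ v ∈ S, ¬ hd v → v ∉ H) (s c : ℕ) (y : ℤ) :
    shellCount π S H (2 * s + c) c y =
      ∑ w ∈ range (c + 1), (((N - s - w).choose (c - w) * (s + w).choose w : ℕ) : ℝ) *
        shellCount π S H (2 * (s + w)) 0 y := by
  classical
  unfold shellCount
  rw [card_eq_sum_card_fiberwise (f := fun U => ((half π U).filter fun v => hd v).card) (t := range (c + 1))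
    (fun U hU => by
      simp only [mem_coe, mem_filter, mem_shellIn] at hU
      rw [mem_coe, mem_range, Nat.lt_succ_iff, ← hU.1.2.2]
      exact card_filter_le _ _)]
  push_cast
  refine sum_congr rfl fun w hw => ?_
  have hwc : w ≤ c := Nat.lt_succ_iff.1 (mem_range.1 hw)
  rw [filter_filter]
  have e : ((shellIn π S (2 * s + c) c).filter fun U =>
      ((U ∩ H).card : ℤ) = y ∧ ((half π U).filter fun v => hd v).card = w) =
      (shellIn π S (2 * s + c) c).filter fun U =>
        ((half π U).filter fun v => hd v).card = w ∧ ((U ∩ H).card : ℤ) = y :=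
    filter_congr fun U _ => and_comm
  rw [e, card_filter_headCount_eq hπ hS hN H hd hflip htail s c w hwc y,
    card_filter_allHead_eq hπ hS H hd hflip htail s w y]
  push_cast
  ring

/-- **(K1), COUNT FORM.** For a `π`-stable ground set `S` with `|S| = 2N` and a block `H` with NO `HH` edge
inside `S`: `Sh_S(2s+c, c; y) = Σ_{w ≤ c} C(N−s−w, c−w)·C(s+w, w)·Sh_S(2(s+w), 0; y)` for all `s, c, y`.
[cite: Rothvoss2017, §2 (PDF p. 6)] -/
theorem shellCount_eq_sum_levelZero {S : Finset (Fin n)} (hS : ∀ v ∈ S, π v ∈ S) {N : ℕ}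
    (hN : S.card = 2 * N) {H : Finset (Fin n)} (hA : ∀ v ∈ S, ¬ (v ∈ H ∧ π v ∈ H)) (s c : ℕ) (y : ℤ) :
    shellCount π S H (2 * s + c) c y =
      ∑ w ∈ range (c + 1), (((N - s - w).choose (c - w) * (s + w).choose w : ℕ) : ℝ) *
        shellCount π S H (2 * (s + w)) 0 y := by
  classical
  obtain ⟨hflip, htail⟩ := blockOrientation_spec hπ hπ' hA
  exact shellCount_eq_sum_levelZero_of_orientation hπ hS hN H (fun v => v ∈ H ∨ (π v ∉ H ∧ v < π v))
    hflip htail s c y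

/-! ### §5 Shell sizes and the law form -/

omit hπ hπ' in
/-- The binomial bookkeeping `C(N−s−w, c−w)·C(s+w, w)·C(N, s+w) = C(N, s)·C(N−s, c)·C(c, w)` (`w ≤ c`).
[cite: ChattamvelliShanmugam2020, §7.1 (binomial-coefficient identities behind the hypergeometric law)] -/
private theorem choose_bookkeeping (N s c w : ℕ) (hwc : w ≤ c) :
    (N - s - w).choose (c - w) * (s + w).choose w * N.choose (s + w) =
      N.choose s * (N - s).choose c * c.choose w := by
  -- `C(N, s+w)·C(s+w, s) = C(N, s)·C(N−s, w)` and `C(N−s, c)·C(c, w) = C(N−s, w)·C(N−s−w, c−w)`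
  rw [(Nat.choose_symm_add (a := s) (b := w)).symm]
  have e1 : N.choose (s + w) * (s + w).choose s = N.choose s * (N - s).choose (s + w - s) :=
    Nat.choose_mul (Nat.le_add_right s w)
  rw [Nat.add_sub_cancel_left] at e1
  have e2 : (N - s).choose c * c.choose w = (N - s).choose w * (N - s - w).choose (c - w) := Nat.choose_mul hwc
  calc (N - s - w).choose (c - w) * (s + w).choose s * N.choose (s + w)
      = (N.choose (s + w) * (s + w).choose s) * (N - s - w).choose (c - w) := by ring
    _ = N.choose s * ((N - s).choose w * (N - s - w).choose (c - w)) := by rw [e1]; ring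
    _ = N.choose s * (N - s).choose c * c.choose w := by rw [← e2]; ring

/-- **The size of a shell**: a `π`-stable `S` with `N` edges has `|Shell_S(2s+c, c)| = C(N,s)·C(N−s,c)·2^c`
(`s` full edges, `c` half edges, an endpoint of each) — the case `H = ∅` of (K1) with `|Shell_S(2k,0)| = C(N,k)`.
[cite: Rothvoss2017, §2 (PDF p. 6)] -/
theorem card_shellIn_eq_choose {S : Finset (Fin n)} (hS : ∀ v ∈ S, π v ∈ S) {N : ℕ} (hN : S.card = 2 * N)
    (s c : ℕ) : (shellIn π S (2 * s + c) c).card = N.choose s * (N - s).choose c * 2 ^ c := by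
  classical
  have hreps : (reps π S).card = N := by have := two_mul_card_reps hπ hπ' hS; omega
  -- (K1) at `H = ∅`, `y = 0`
  have h := shellCount_eq_sum_levelZero hπ hπ' hS hN (H := ∅) (fun v _ h => notMem_empty v h.1) s c 0
  have hcount : ∀ t c', shellCount π S ∅ t c' 0 = ((shellIn π S t c').card : ℝ) := by
    intro t c'
    unfold shellCount
    rw [filter_true_of_mem fun U _ => by simp]
  simp only [hcount] at h
  have hz : ∀ w, (shellIn π S (2 * (s + w)) 0).card = N.choose (s + w) := fun w => by
    rw [card_shellIn_zero hπ hπ' hS, hreps]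
  simp only [hz] at h
  have h' : ((shellIn π S (2 * s + c) c).card : ℝ) =
      ∑ w ∈ range (c + 1), ((N.choose s * (N - s).choose c * c.choose w : ℕ) : ℝ) := by
    rw [h]
    refine sum_congr rfl fun w hw => ?_
    rw [← choose_bookkeeping N s c w (Nat.lt_succ_iff.1 (mem_range.1 hw))]
    push_cast; ring
  rw [← Nat.cast_sum, Nat.cast_inj] at h'
  rw [h', ← mul_sum, Nat.sum_range_choose]

omit hπ hπ' in
/-- Counts from laws: `Sh_S(t,c;y) = law_S(t,c;y)·|Shell_S(t,c)|` (both vanish on an empty shell).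
[cite: Rothvoss2017, §2 (PDF p. 6)] -/
theorem shellCount_eq_shellLaw_mul_card (S H : Finset (Fin n)) (t c : ℕ) (y : ℤ) :
    shellCount π S H t c y = shellLaw π S H t c y * (shellIn π S t c).card := by
  classical
  rw [shellLaw]
  rcases Nat.eq_zero_or_pos (shellIn π S t c).card with h | h
  · have h0 : shellCount π S H t c y = 0 := by
      unfold shellCount
      rw [Nat.cast_eq_zero, ← Nat.le_zero, ← h]
      exact card_filter_le _ _
    rw [h0, h]; simp
  · have : ((shellIn π S t c).card : ℝ) ≠ 0 := by exact_mod_cast h.ne'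
    field_simp

/-- **(K1), LAW FORM (the population mixture).** For a `π`-stable `S` with `N` edges, a block `H` with no `HH`
edge inside `S`, and `s + c ≤ N` (so that every shell involved is nonempty):
`law_S(2s+c, c; y) = Σ_{w ≤ c} C(c,w)·2^{−c} · law_S(2(s+w), 0; y)` — given the total score `K = s + w`,
`w ~ Bin(c,½)`, the block statistic is the level-`0` (hypergeometric) law with `K` full edges.
[cite: Rothvoss2017, §2 (PDF p. 6)] [cite: VatutinMikhailov1983, §2] -/
theorem shellLaw_eq_binomialMixture_levelZero {S : Finset (Fin n)} (hS : ∀ v ∈ S, π v ∈ S) {N : ℕ}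
    (hN : S.card = 2 * N) {H : Finset (Fin n)} (hA : ∀ v ∈ S, ¬ (v ∈ H ∧ π v ∈ H)) {s c : ℕ}
    (hsc : s + c ≤ N) (y : ℤ) :
    shellLaw π S H (2 * s + c) c y =
      ∑ w ∈ range (c + 1), ((c.choose w : ℕ) : ℝ) / 2 ^ c * shellLaw π S H (2 * (s + w)) 0 y := by
  classical
  have hreps : (reps π S).card = N := by have := two_mul_card_reps hπ hπ' hS; omega
  have hcard := card_shellIn_eq_choose hπ hπ' hS hN s c
  have hpos : 0 < N.choose s * (N - s).choose c * 2 ^ c :=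
    Nat.mul_pos (Nat.mul_pos (Nat.choose_pos (by omega)) (Nat.choose_pos (by omega))) (Nat.two_pow_pos c)
  have hz : ∀ w, (shellIn π S (2 * (s + w)) 0).card = N.choose (s + w) := fun w => by
    rw [card_shellIn_zero hπ hπ' hS, hreps]
  rw [shellLaw, shellCount_eq_sum_levelZero hπ hπ' hS hN hA s c y, hcard, sum_div]
  refine sum_congr rfl fun w hw => ?_
  have hwc : w ≤ c := Nat.lt_succ_iff.1 (mem_range.1 hw)
  rw [shellCount_eq_shellLaw_mul_card, hz]
  have hbk := choose_bookkeeping N s c w hwc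
  have hD : ((N.choose s * (N - s).choose c * 2 ^ c : ℕ) : ℝ) ≠ 0 := by exact_mod_cast hpos.ne'
  have h2c : (2 : ℝ) ^ c ≠ 0 := pow_ne_zero _ two_ne_zero
  rw [div_eq_iff hD, div_mul_eq_mul_div, div_mul_eq_mul_div, eq_div_iff h2c]
  have hbkR : (((N - s - w).choose (c - w) : ℕ) : ℝ) * ((s + w).choose w : ℕ) * (N.choose (s + w) : ℕ) =
      (N.choose s : ℕ) * ((N - s).choose c : ℕ) * (c.choose w : ℕ) := by exact_mod_cast hbk
  push_cast
  linear_combination (shellLaw π S H (2 * (s + w)) 0 y * 2 ^ c) * hbkR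

/-- **(K1) in the binomial-profile currency of `BinomialSmoothingProfile` (eng g23, (L-K2)).** For a
`π`-stable `S` with `N` edges, a block `H` with no `HH` edge inside `S`, `j ≤ s₀` and `s₀ + j + 1 ≤ N`: the odd
profile `j ↦ law_S(2s₀+1, 2j+1; y)` is the `Bin(2j+1,½)`-average of the kernel `K ↦ law_S(2K, 0; y)` started at
`s₀ − j` — so `(L-K2)`'s `fwdDiff_iter_binomialProfile` turns its level differences into quarter second
differences of the hypergeometric kernel. [cite: Rothvoss2017, §2 (PDF p. 6)] [cite: VatutinMikhailov1983, §2] -/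
theorem shellLaw_odd_eq_binomialProfile {S : Finset (Fin n)} (hS : ∀ v ∈ S, π v ∈ S) {N : ℕ}
    (hN : S.card = 2 * N) {H : Finset (Fin n)} (hA : ∀ v ∈ S, ¬ (v ∈ H ∧ π v ∈ H)) {s₀ j : ℕ}
    (hj : j ≤ s₀) (hs₀ : s₀ + j + 1 ≤ N) (y : ℤ) :
    shellLaw π S H (2 * s₀ + 1) (2 * j + 1) y =
      ∑ w ∈ range (2 * j + 2), ((2 * j + 1).choose w : ℝ) / 2 ^ (2 * j + 1) *
        (fun K : ℤ => shellLaw π S H (2 * K.toNat) 0 y) ((s₀ : ℤ) - j + w) := by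
  have h := shellLaw_eq_binomialMixture_levelZero hπ hπ' hS hN hA (s := s₀ - j) (c := 2 * j + 1) (by omega) y
  rw [show 2 * (s₀ - j) + (2 * j + 1) = 2 * s₀ + 1 by omega] at h
  rw [h]
  refine sum_congr rfl fun w _ => ?_
  have e : ((s₀ : ℤ) - j + w).toNat = s₀ - j + w := by omega
  simp only [e]

/-! ### §6 Level `0` of a block with no `HH` edge is hypergeometric -/

/-- **Level-`0` counts are hypergeometric coefficients**: for a `π`-stable `S` of type `(0, b, d)` w.r.t. `H`
(no `HH` edge, `b` mixed edges, `d` edges disjoint from `H`), `Sh_S(2r, 0; y) = coeff_y H_{b,d,r} = C(b,y)·C(d,r−y)`.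
[cite: Rothvoss2017, §2 (PDF p. 6)] [cite: VatutinMikhailov1983, §2] -/
theorem shellCount_zero_eq_coeff_hyperGen {S : Finset (Fin n)} (hS : ∀ v ∈ S, π v ∈ S) (H : Finset (Fin n))
    (h0 : (reps π (vAA π S H)).card = 0) (r y : ℕ) :
    shellCount π S H (2 * r) 0 (y : ℤ) =
      (hyperGen (reps π (vBH π S H ∪ vBN π S H)).card (reps π (vDD π S H)).card r).coeff y := by
  rw [← coeff_shellGen, shellGen_zero_eq_sum_hyperGen hπ hπ' hS H r, h0, finsetSum_coeff,
    sum_range_succ', sum_eq_zero fun α _ => ?_]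
  · simp
  · rw [Nat.choose_zero_succ]; simp

/-- **Level-`0` laws are hypergeometric**: under the same hypotheses and `|S| = 2N` (so `N = b + d`),
`law_S(2r, 0; y) = coeff_y H_{b,d,r} / C(N, r)`. [cite: ChattamvelliShanmugam2020, §7.4]
[cite: VatutinMikhailov1983, §2] -/
theorem shellLaw_zero_eq {S : Finset (Fin n)} (hS : ∀ v ∈ S, π v ∈ S) {N : ℕ} (hN : S.card = 2 * N)
    (H : Finset (Fin n)) (h0 : (reps π (vAA π S H)).card = 0) (r y : ℕ) :
    shellLaw π S H (2 * r) 0 (y : ℤ) =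
      (hyperGen (reps π (vBH π S H ∪ vBN π S H)).card (reps π (vDD π S H)).card r).coeff y / N.choose r := by
  have hreps : (reps π S).card = N := by have := two_mul_card_reps hπ hπ' hS; omega
  rw [shellLaw, shellCount_zero_eq_coeff_hyperGen hπ hπ' hS H h0, card_shellIn_zero hπ hπ' hS, hreps]

/-! ### §7 (K0) Splitting off the `HH` class: reduction of a general type to type `(0,b,d)` -/

omit hπ' in
/-- Half vertices and a `π`-stable class: `half(U ∩ C) = half(U) ∩ C` and `half(U ∖ C) = half(U) ∖ C` for
`π`-stable `C`. [cite: Rothvoss2017, §2 (PDF p. 5)] -/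
theorem half_inter_class {U C : Finset (Fin n)} (hC : ∀ v ∈ C, π v ∈ C) :
    half π (U ∩ C) = half π U ∩ C ∧ half π (U \ C) = half π U \ C := by
  have hC' : ∀ v, π v ∈ C → v ∈ C := fun v h => by have := hC _ h; rwa [hπ] at this
  constructor
  · ext v
    simp only [mem_half, mem_inter, not_and]
    constructor
    · rintro ⟨⟨hvU, hvC⟩, h⟩
      exact ⟨⟨hvU, fun hπvU => h hπvU (hC v hvC)⟩, hvC⟩
    · rintro ⟨⟨hvU, hπvU⟩, hvC⟩
      exact ⟨⟨hvU, hvC⟩, fun h => absurd h hπvU⟩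
  · ext v
    simp only [mem_half, mem_sdiff, not_and, not_not]
    constructor
    · rintro ⟨⟨hvU, hvC⟩, h⟩
      exact ⟨⟨hvU, fun hπvU => hvC (hC' v (h hπvU))⟩, hvC⟩
    · rintro ⟨⟨hvU, hπvU⟩, hvC⟩
      exact ⟨⟨hvU, hvC⟩, fun h => absurd h hπvU⟩

omit hπ' in
/-- **Splitting a shell along a `π`-stable class, at every level.** For `π`-stable `C ⊆ S` and any property
`P` of the part outside `C`:
`#{U ∈ Shell_S(t,c) : |U ∩ C| = t₁, |half(U) ∩ C| = c₁, P(U ∖ C)} = |Shell_C(t₁,c₁)| · #{U′ ∈ Shell_{S∖C}(t−t₁, c−c₁) : P(U′)}`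
(`U ↦ (U ∩ C, U ∖ C)` is a bijection; the level-`0` case is `ShellLawLevelStep.card_shellIn_zero_split`).
[cite: Rothvoss2017, §2 (PDF p. 6)] -/
theorem card_shellIn_split_class {S C : Finset (Fin n)} (hC : ∀ v ∈ C, π v ∈ C) (hCS : C ⊆ S) (P : Finset (Fin n) → Prop) [DecidablePred P] {t c t₁ c₁ : ℕ} (ht : t₁ ≤ t)
    (hc : c₁ ≤ c) :
    ((shellIn π S t c).filter fun U => (U ∩ C).card = t₁ ∧ (half π U ∩ C).card = c₁ ∧ P (U \ C)).card =
      (shellIn π C t₁ c₁).card * ((shellIn π (S \ C) (t - t₁) (c - c₁)).filter P).card := by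
  classical
  rw [← card_product]
  refine card_nbij' (fun U => (U ∩ C, U \ C)) (fun AB => AB.1 ∪ AB.2) ?_ ?_ ?_ ?_
  · intro U hU
    simp only [mem_coe, mem_filter, mem_shellIn] at hU
    obtain ⟨⟨hUS, hUt, hUc⟩, hU1, hU2, hUP⟩ := hU
    obtain ⟨h1, h2⟩ := half_inter_class hπ (U := U) hC
    have hc12 := card_sdiff_add_card_inter (half π U) C
    have ht12 := card_sdiff_add_card_inter U C
    simp only [mem_coe, mem_product, mem_filter, mem_shellIn]
    refine ⟨⟨inter_subset_right, hU1, by rw [h1, hU2]⟩, ⟨fun v hv => mem_sdiff.2 ⟨hUS (mem_sdiff.1 hv).1,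
      (mem_sdiff.1 hv).2⟩, by omega, by rw [h2]; omega⟩, hUP⟩
  · rintro ⟨A, B⟩ hAB
    simp only [mem_coe, mem_product, mem_filter, mem_shellIn] at hAB
    obtain ⟨⟨hAC, hAt, hAc⟩, ⟨hBS, hBt, hBc⟩, hBP⟩ := hAB
    have hdisj : Disjoint A B := disjoint_of_subset_left hAC (disjoint_of_subset_right hBS disjoint_sdiff)
    have hinter : (A ∪ B) ∩ C = A := by
      rw [union_inter_distrib_right, inter_eq_left.2 hAC,
        ((disjoint_of_subset_left hBS) sdiff_disjoint |> disjoint_iff_inter_eq_empty.1), union_empty]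
    have hsdiff : (A ∪ B) \ C = B := by
      rw [union_sdiff_distrib, sdiff_eq_empty_iff_subset.2 hAC, empty_union]
      exact sdiff_eq_self_of_disjoint ((disjoint_of_subset_left hBS) sdiff_disjoint)
    obtain ⟨h1, h2⟩ := half_inter_class hπ (U := A ∪ B) hC
    rw [hinter] at h1
    rw [hsdiff] at h2
    have hc12 := card_sdiff_add_card_inter (half π (A ∪ B)) C
    simp only [mem_coe, mem_filter, mem_shellIn]
    refine ⟨⟨union_subset (hAC.trans hCS) (hBS.trans sdiff_subset), ?_, ?_⟩, ?_, ?_, ?_⟩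
    · rw [card_union_of_disjoint hdisj, hAt, hBt]; omega
    · rw [← h1, ← h2, hAc, hBc] at hc12; omega
    · rw [hinter, hAt]
    · rw [← h1, hAc]
    · rw [hsdiff]; exact hBP
  · intro U _
    show U ∩ C ∪ U \ C = U
    rw [union_comm, sdiff_union_inter]
  · rintro ⟨A, B⟩ hAB
    simp only [mem_coe, mem_product, mem_filter, mem_shellIn] at hAB
    obtain ⟨⟨hAC, _, _⟩, ⟨hBS, _, _⟩, _⟩ := hAB
    have hinter : (A ∪ B) ∩ C = A := by
      rw [union_inter_distrib_right, inter_eq_left.2 hAC,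
        ((disjoint_of_subset_left hBS) sdiff_disjoint |> disjoint_iff_inter_eq_empty.1), union_empty]
    have hsdiff : (A ∪ B) \ C = B := by
      rw [union_sdiff_distrib, sdiff_eq_empty_iff_subset.2 hAC, empty_union]
      exact sdiff_eq_self_of_disjoint ((disjoint_of_subset_left hBS) sdiff_disjoint)
    show ((A ∪ B) ∩ C, (A ∪ B) \ C) = (A, B)
    rw [hinter, hsdiff]

omit hπ hπ' in
/-- The ground set minus its `HH` class has no `HH` edge, and is `π`-stable. [cite: Rothvoss2017, §2 (PDF p. 5)] -/
theorem sdiff_vAA_noHH (hπ : ∀ v, π (π v) = v) {S : Finset (Fin n)} (hS : ∀ v ∈ S, π v ∈ S)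
    (H : Finset (Fin n)) :
    (∀ v ∈ S \ vAA π S H, π v ∈ S \ vAA π S H) ∧ ∀ v ∈ S \ vAA π S H, ¬ (v ∈ H ∧ π v ∈ H) := by
  constructor
  · intro v hv
    obtain ⟨hvS, hvA⟩ := mem_sdiff.1 hv
    refine mem_sdiff.2 ⟨hS v hvS, fun h => hvA ?_⟩
    have := vAA_stable hπ S H hS _ h
    rwa [hπ] at this
  · intro v hv h
    obtain ⟨hvS, hvA⟩ := mem_sdiff.1 hv
    exact hvA (mem_vAA.2 ⟨hvS, h.1, h.2⟩)

omit hπ' in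
/-- **(K0) The `HH`-class reduction.** For a `π`-stable `S`, a block `H` with `HH` class `AA = vAA_S(H)`, and all
`t, c, y`: `Sh_S(t, c; y) = Σ_{t₁ ≤ t} Σ_{c₁ ≤ c} |Shell_{AA}(t₁, c₁)| · Sh_{S∖AA}(t − t₁, c − c₁; y − t₁)` —
condition on the trace `U ∩ AA` (every vertex of `AA` lies in `H`, so it contributes `|U ∩ AA| = t₁` to the
block statistic); the remaining ground set `S ∖ AA` has type `(0, b, d)`, where (K1) applies, and
`|Shell_{AA}(2s₁+c₁, c₁)| = C(a,s₁)·C(a−s₁,c₁)·2^{c₁}` (`card_shellIn_eq_choose`; shells with `t₁ − c₁` odd are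
empty). [cite: Rothvoss2017, §2 (PDF p. 6)] -/
theorem shellCount_eq_sum_split_vAA {S : Finset (Fin n)} (hS : ∀ v ∈ S, π v ∈ S) (H : Finset (Fin n))
    (t c : ℕ) (y : ℤ) :
    shellCount π S H t c y =
      ∑ t₁ ∈ range (t + 1), ∑ c₁ ∈ range (c + 1), ((shellIn π (vAA π S H) t₁ c₁).card : ℝ) *
        shellCount π (S \ vAA π S H) H (t - t₁) (c - c₁) (y - t₁) := by
  classical
  set C := vAA π S H with hCdef
  have hC : ∀ v ∈ C, π v ∈ C := vAA_stable hπ S H hS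
  have hCS : C ⊆ S := filter_subset _ _
  have hCH : ∀ v ∈ C, v ∈ H := fun v hv => (mem_vAA.1 hv).2.1
  unfold shellCount
  rw [card_eq_sum_card_fiberwise (f := fun U => ((U ∩ C).card, (half π U ∩ C).card))
    (t := range (t + 1) ×ˢ range (c + 1)) (fun U hU => by
      simp only [mem_coe, mem_filter, mem_shellIn] at hU
      simp only [mem_coe, mem_product, mem_range, Nat.lt_succ_iff]
      exact ⟨(card_le_card inter_subset_left).trans hU.1.2.1.le,
        (card_le_card inter_subset_left).trans hU.1.2.2.le⟩),
    sum_product]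
  push_cast
  refine sum_congr rfl fun t₁ ht₁ => sum_congr rfl fun c₁ hc₁ => ?_
  have ht : t₁ ≤ t := Nat.lt_succ_iff.1 (mem_range.1 ht₁)
  have hc : c₁ ≤ c := Nat.lt_succ_iff.1 (mem_range.1 hc₁)
  rw [filter_filter]
  have e : ((shellIn π S t c).filter fun U => ((U ∩ H).card : ℤ) = y ∧
      ((U ∩ C).card, (half π U ∩ C).card) = (t₁, c₁)) =
      (shellIn π S t c).filter fun U => (U ∩ C).card = t₁ ∧ (half π U ∩ C).card = c₁ ∧
        (((U \ C) ∩ H).card : ℤ) = y - t₁ := by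
    refine filter_congr fun U _ => ?_
    have hsplit : (U ∩ H).card = (U ∩ C).card + ((U \ C) ∩ H).card := by
      have hd : Disjoint (U ∩ C) ((U \ C) ∩ H) :=
        disjoint_left.2 fun v hv hv' => (mem_sdiff.1 (mem_inter.1 hv').1).2 (mem_inter.1 hv).2
      rw [← card_union_of_disjoint hd]
      congr 1
      ext v
      simp only [mem_inter, mem_union, mem_sdiff]
      constructor
      · rintro ⟨hvU, hvH⟩
        by_cases hvC : v ∈ C
        · exact Or.inl ⟨hvU, hvC⟩
        · exact Or.inr ⟨⟨hvU, hvC⟩, hvH⟩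
      · rintro (⟨hvU, hvC⟩ | ⟨⟨hvU, _⟩, hvH⟩)
        · exact ⟨hvU, hCH v hvC⟩
        · exact ⟨hvU, hvH⟩
    simp only [Prod.mk.injEq]
    constructor
    · rintro ⟨hy, h1, h2⟩
      refine ⟨h1, h2, ?_⟩
      rw [hsplit, h1] at hy; push_cast at hy; linarith
    · rintro ⟨h1, h2, hy⟩
      refine ⟨?_, h1, h2⟩
      rw [hsplit, h1]; push_cast; linarith
  rw [e, card_shellIn_split_class hπ hC hCS (fun B => ((B ∩ H).card : ℤ) = y - t₁) ht hc]
  push_cast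
  rfl

/-! ### §8 (LP) The touch-class split: at fixed cut size the shell law is a pattern polynomial in the level

For a block `H` write `DD := vDD_S(H)` (the `d` edges of `S` disjoint from `H`) and `T := S ∖ DD` (the vertices
on the `k = N − d = a + b` edges MEETING `H`). The block statistic `|U ∩ H|` only sees `U ∩ T = U ∖ DD`.
Classifying a cut `U ∈ Shell_S(2s+c, c)` by its trace pattern on `T` — `f` full edges and `h` half edges of
`U` inside `T` — and counting the completions on `DD` (`s − f` full and `c − h` half edges there) gives the
COUNT FORM `Sh_S(2s+c, c; y) = Σ_{f ≤ s} Σ_{h ≤ c} C(d, s−f)·C(d−(s−f), c−h)·2^{c−h} · Sh_T(2f+h, h; y)` and,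
after division by `|Shell_S(2s+c,c)| = C(N,s)·C(N−s,c)·2^c` (`card_shellIn_eq_choose`), the LAW FORM
`law_S(2s+c, c; y) = Σ_{f,h} Sh_T(2f+h, h; y)·2^{−h}·(s)_f·(c)_h·(N−s−c)_{k−f−h} / (N)_k`
(falling factorials): at fixed `t = 2s + c` this is ONE polynomial of degree `≤ k = a + b` in the level `c`
(`(s)_f = Π_{i<f}((t−c)/2 − i)`, `(N−s−c)_e = Π_{i<e}(N − (t+c)/2 − i)`), whose value at `c = 0`, `s = t/2` is the
canonical «virtual level-`0` law» of the block (HOME pnp-psdrank-lit/LIT-52.md (I); exact checks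
num/g36/check_level_poly.py). No orientation and no hypothesis on the type are needed here. -/

/-- For a cut `U` and a `π`-stable class `C`: `|U ∖ C| = 2·|reps(full(U) ∖ C)| + |half(U) ∖ C|` — outside `C`
the cut consists of whole edges (an even number of vertices) and half vertices.
[cite: Rothvoss2017, §2 (PDF p. 5)] -/
theorem card_sdiff_class_eq {U C : Finset (Fin n)} (hC : ∀ v ∈ C, π v ∈ C) :
    (U \ C).card = 2 * (reps π (full π U \ C)).card + (half π U \ C).card := by
  have hC' : ∀ v, π v ∈ C → v ∈ C := fun v h => by have := hC _ h; rwa [hπ] at this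
  have hst : ∀ v ∈ full π U \ C, π v ∈ full π U \ C := by
    intro v hv
    obtain ⟨hvF, hvC⟩ := mem_sdiff.1 hv
    obtain ⟨hvU, hπvU⟩ := mem_full.1 hvF
    exact mem_sdiff.2 ⟨mem_full.2 ⟨hπvU, by rw [hπ]; exact hvU⟩, fun h => hvC (hC' v h)⟩
  rw [two_mul_card_reps hπ hπ' hst]
  have hU : U \ C = (full π U \ C) ∪ (half π U \ C) := by
    ext v
    simp only [mem_sdiff, mem_union, mem_full, mem_half]
    tauto
  have hd : Disjoint (full π U \ C) (half π U \ C) := disjoint_left.2 fun v h1 h2 =>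
    (mem_half.1 (mem_sdiff.1 h2).1).2 (mem_full.1 (mem_sdiff.1 h1).1).2
  rw [hU, card_union_of_disjoint hd]

omit hπ hπ' in
/-- The class of vertices of `S` on edges meeting `H` is `S ∖ vDD_S(H)`; it is `π`-stable and contains
`S ∩ H`. [cite: Rothvoss2017, §2 (PDF p. 5)] -/
theorem sdiff_vDD_stable (hπ : ∀ v, π (π v) = v) {S : Finset (Fin n)} (hS : ∀ v ∈ S, π v ∈ S)
    (H : Finset (Fin n)) :
    (∀ v ∈ S \ vDD π S H, π v ∈ S \ vDD π S H) ∧ ∀ v ∈ S, v ∈ H → v ∈ S \ vDD π S H := by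
  constructor
  · intro v hv
    obtain ⟨hvS, hvD⟩ := mem_sdiff.1 hv
    refine mem_sdiff.2 ⟨hS v hvS, fun h => hvD ?_⟩
    have := vDD_stable hπ S H hS _ h
    rwa [hπ] at this
  · intro v hvS hvH
    exact mem_sdiff.2 ⟨hvS, fun h => (mem_vDD.1 h).2.1 hvH⟩

/-- **(LP), COUNT FORM — the touch-class split.** For a `π`-stable `S`, a block `H` whose `NN` class
`DD = vDD_S(H)` has `d` edges, and all `s, c, y`:
`Sh_S(2s+c, c; y) = Σ_{f ≤ s} Σ_{h ≤ c} C(d, s−f)·C(d−(s−f), c−h)·2^{c−h} · Sh_{S∖DD}(2f+h, h; y)`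
— classify the cut by the numbers `f`, `h` of its full and half edges meeting `H`; the block statistic is
carried by `U ∖ DD`, and the completions on `DD` are counted by `card_shellIn_eq_choose`.
[cite: Rothvoss2017, §2 (PDF p. 6)] -/
theorem shellCount_eq_sum_split_touch {S : Finset (Fin n)} (hS : ∀ v ∈ S, π v ∈ S) (H : Finset (Fin n))
    {d : ℕ} (hd : (reps π (vDD π S H)).card = d) (s c : ℕ) (y : ℤ) :
    shellCount π S H (2 * s + c) c y =
      ∑ f ∈ range (s + 1), ∑ h ∈ range (c + 1),
        ((d.choose (s - f) * (d - (s - f)).choose (c - h) * 2 ^ (c - h) : ℕ) : ℝ) *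
          shellCount π (S \ vDD π S H) H (2 * f + h) h y := by
  classical
  set C := vDD π S H with hCdef
  have hC : ∀ v ∈ C, π v ∈ C := vDD_stable hπ S H hS
  have hCS : C ⊆ S := filter_subset _ _
  have hCH : ∀ v ∈ C, v ∉ H := fun v hv => (mem_vDD.1 hv).2.1
  have hDcard : C.card = 2 * d := by rw [← hd, two_mul_card_reps hπ hπ' hC]
  unfold shellCount
  rw [card_eq_sum_card_fiberwise (f := fun U => ((reps π (full π U \ C)).card, (half π U \ C).card))
    (t := range (s + 1) ×ˢ range (c + 1)) (fun U hU => by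
      simp only [mem_coe, mem_filter, mem_shellIn] at hU
      obtain ⟨⟨hUS, hUt, hUc⟩, _⟩ := hU
      simp only [mem_coe, mem_product, mem_range, Nat.lt_succ_iff]
      have hfull : ∀ v ∈ full π U, π v ∈ full π U := fun v hv => by
        obtain ⟨hvU, hπvU⟩ := mem_full.1 hv
        exact mem_full.2 ⟨hπvU, by rw [hπ]; exact hvU⟩
      have h2 := two_mul_card_reps hπ hπ' hfull
      have h3 := card_full_add_card_half (π := π) U
      have h4 : (reps π (full π U \ C)).card ≤ (reps π (full π U)).card :=
        card_le_card (fun v hv => by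
          rw [mem_reps] at hv ⊢
          exact ⟨(mem_sdiff.1 hv.1).1, hv.2⟩)
      have h5 : (half π U \ C).card ≤ (half π U).card := card_le_card sdiff_subset
      constructor <;> omega),
    sum_product]
  push_cast
  refine sum_congr rfl fun f hf => sum_congr rfl fun h hh => ?_
  have hf' : f ≤ s := Nat.lt_succ_iff.1 (mem_range.1 hf)
  have hh' : h ≤ c := Nat.lt_succ_iff.1 (mem_range.1 hh)
  rw [filter_filter]
  have e : ((shellIn π S (2 * s + c) c).filter fun U => ((U ∩ H).card : ℤ) = y ∧
      ((reps π (full π U \ C)).card, (half π U \ C).card) = (f, h)) =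
      (shellIn π S (2 * s + c) c).filter fun U => (U ∩ C).card = 2 * s + c - (2 * f + h) ∧
        (half π U ∩ C).card = c - h ∧ (((U \ C) ∩ H).card : ℤ) = y := by
    refine filter_congr fun U hU => ?_
    obtain ⟨hUS, hUt, hUc⟩ := mem_shellIn.1 hU
    have hsplit : U ∩ H = (U \ C) ∩ H := by
      ext v
      simp only [mem_inter, mem_sdiff]
      constructor
      · rintro ⟨hvU, hvH⟩
        exact ⟨⟨hvU, fun hvC => hCH v hvC hvH⟩, hvH⟩
      · rintro ⟨⟨hvU, _⟩, hvH⟩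
        exact ⟨hvU, hvH⟩
    have h1 := card_sdiff_add_card_inter U C
    have h2 := card_sdiff_add_card_inter (half π U) C
    have h3 := card_sdiff_class_eq hπ hπ' (U := U) hC
    rw [hsplit]
    simp only [Prod.mk.injEq]
    constructor
    · rintro ⟨hy, hrf, hrh⟩
      exact ⟨by omega, by omega, hy⟩
    · rintro ⟨hUC, hhC, hy⟩
      exact ⟨hy, by omega, by omega⟩
  rw [e, card_shellIn_split_class hπ hC hCS (fun B => ((B ∩ H).card : ℤ) = y) (by omega) (by omega)]
  have e1 : 2 * s + c - (2 * f + h) = 2 * (s - f) + (c - h) := by omega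
  rw [e1]
  have e2 : 2 * s + c - (2 * (s - f) + (c - h)) = 2 * f + h := by omega
  have e3 : c - (c - h) = h := by omega
  rw [e2, e3, card_shellIn_eq_choose hπ hπ' hC hDcard]
  push_cast
  ring

omit hπ hπ' in
/-- The bookkeeping behind the law form: for `d ≤ N`, `f ≤ s`, `h ≤ c`, `s + c ≤ N`, `d + f + h ≤ N`,
`C(d, s−f)·C(d−(s−f), c−h)·2^{c−h}·2^h·(N)_{N−d} = C(N,s)·C(N−s,c)·2^c·(s)_f·(c)_h·(N−s−c)_{N−d−f−h}`
(both sides vanish unless `(s−f)+(c−h) ≤ d`).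
[cite: ChattamvelliShanmugam2020, §7.1 (binomial-coefficient identities behind the hypergeometric law)] -/
private theorem touch_bookkeeping (N d s c f h : ℕ) (hdN : d ≤ N) (hf : f ≤ s) (hh : h ≤ c)
    (hsc : s + c ≤ N) (hfh : d + f + h ≤ N) :
    d.choose (s - f) * (d - (s - f)).choose (c - h) * 2 ^ (c - h) * 2 ^ h * N.descFactorial (N - d) =
      N.choose s * (N - s).choose c * 2 ^ c *
        (s.descFactorial f * c.descFactorial h * (N - s - c).descFactorial (N - d - f - h)) := by
  by_cases hcase : (s - f) + (c - h) ≤ d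
  · -- all factorials are honest: clear denominators in `ℚ`
    have hdesc : ∀ {m j : ℕ}, j ≤ m → (m.descFactorial j : ℚ) = (m.factorial : ℚ) / ((m - j).factorial : ℚ) :=
      fun {m j} hj => by
        rw [eq_div_iff (by positivity), mul_comm]
        exact_mod_cast Nat.factorial_mul_descFactorial hj
    have q1 : s - f ≤ d := by omega
    have q2 : c - h ≤ d - (s - f) := by omega
    have q3 : s ≤ N := by omega
    have q4 : c ≤ N - s := by omega
    have q5 : N - d ≤ N := Nat.sub_le _ _
    have q6 : N - d - f - h ≤ N - s - c := by omega
    have r1 : N - (N - d) = d := by omega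
    have r2 : N - s - c - (N - d - f - h) = d - (s - f) - (c - h) := by omega
    suffices hq : ((d.choose (s - f) * (d - (s - f)).choose (c - h) * 2 ^ (c - h) * 2 ^ h *
        N.descFactorial (N - d) : ℕ) : ℚ) = ((N.choose s * (N - s).choose c * 2 ^ c *
        (s.descFactorial f * c.descFactorial h * (N - s - c).descFactorial (N - d - f - h)) : ℕ) : ℚ) by
      exact_mod_cast hq
    push_cast
    rw [Nat.cast_choose ℚ q1, Nat.cast_choose ℚ q2, Nat.cast_choose ℚ q3, Nat.cast_choose ℚ q4,
      hdesc q5, hdesc hf, hdesc hh, hdesc q6, r1, r2]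
    have hpow : (2 : ℚ) ^ (c - h) * 2 ^ h = 2 ^ c := by rw [← pow_add, Nat.sub_add_cancel hh]
    rw [← hpow]
    field_simp
  · -- both sides vanish
    push Not at hcase
    have hz : (N - s - c).descFactorial (N - d - f - h) = 0 :=
      Nat.descFactorial_eq_zero_iff_lt.2 (by omega)
    rw [hz]
    rcases le_or_gt (s - f) d with h1 | h1
    · rw [Nat.choose_eq_zero_of_lt (n := d - (s - f)) (by omega)]; simp
    · rw [Nat.choose_eq_zero_of_lt h1]; simp

/-- **(LP), LAW FORM — the shell law is a pattern polynomial in the level.** For a `π`-stable `S` with `N`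
edges, a block `H` whose `NN` class has `d` edges (so `k := N − d = a + b` edges meet `H`), and `s + c ≤ N`:
`law_S(2s+c, c; y) = Σ_{f ≤ s} Σ_{h ≤ c} Sh_{S∖DD}(2f+h, h; y) · 2^{−h} · (s)_f·(c)_h·(N−s−c)_{k−f−h} / (N)_k`
(`(m)_j = Nat.descFactorial m j`). The weights are the probabilities, under the uniform assignment of
`(s, c, N−s−c)` full/half/empty edges, of a prescribed pattern with `f` full, `h` half and `k−f−h` empty
edges on the `k` edges meeting `H`; at fixed `t = 2s+c` each weight is a polynomial of degree `k` in `c`.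
[cite: Rothvoss2017, §2 (PDF p. 6)] -/
theorem shellLaw_eq_sum_touch_descFactorial {S : Finset (Fin n)} (hS : ∀ v ∈ S, π v ∈ S) {N : ℕ}
    (hN : S.card = 2 * N) (H : Finset (Fin n)) {d : ℕ} (hd : (reps π (vDD π S H)).card = d) (s c : ℕ)
    (hsc : s + c ≤ N) (y : ℤ) :
    shellLaw π S H (2 * s + c) c y =
      ∑ f ∈ range (s + 1), ∑ h ∈ range (c + 1),
        shellCount π (S \ vDD π S H) H (2 * f + h) h y / 2 ^ h *
          ((s.descFactorial f * c.descFactorial h * (N - s - c).descFactorial (N - d - f - h) : ℕ) : ℝ) /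
            (N.descFactorial (N - d) : ℝ) := by
  classical
  have hC : ∀ v ∈ vDD π S H, π v ∈ vDD π S H := vDD_stable hπ S H hS
  have hdN : d ≤ N := by
    have h1 := two_mul_card_reps hπ hπ' hC
    have h2 : (vDD π S H).card ≤ S.card := card_le_card (filter_subset _ _)
    omega
  rw [shellLaw, shellCount_eq_sum_split_touch hπ hπ' hS H hd, card_shellIn_eq_choose hπ hπ' hS hN s c,
    sum_div]
  refine sum_congr rfl fun f hf => ?_
  rw [sum_div]
  refine sum_congr rfl fun h hh => ?_
  have hf' : f ≤ s := Nat.lt_succ_iff.1 (mem_range.1 hf)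
  have hh' : h ≤ c := Nat.lt_succ_iff.1 (mem_range.1 hh)
  by_cases hfh : d + f + h ≤ N
  · have hb := touch_bookkeeping N d s c f h hdN hf' hh' hsc hfh
    have hD : ((N.choose s * (N - s).choose c * 2 ^ c : ℕ) : ℝ) ≠ 0 := by
      have h1 : 0 < N.choose s := Nat.choose_pos (by omega)
      have h2 : 0 < (N - s).choose c := Nat.choose_pos (by omega)
      positivity
    have hF : (N.descFactorial (N - d) : ℝ) ≠ 0 := by
      have := Nat.descFactorial_pos.2 (Nat.sub_le N d)
      exact_mod_cast this.ne'
    have h2h : (2 : ℝ) ^ h ≠ 0 := by positivity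
    rw [div_eq_div_iff hD hF, div_mul_eq_mul_div, div_mul_eq_mul_div, eq_div_iff h2h]
    have hb' := congrArg (fun m : ℕ => (m : ℝ)) hb
    push_cast at hb' ⊢
    linear_combination (shellCount π (S \ vDD π S H) H (2 * f + h) h y) * hb'
  · -- more scoring edges than edges meeting `H`: the inner shell is empty
    have hT : ∀ v ∈ S \ vDD π S H, π v ∈ S \ vDD π S H := (sdiff_vDD_stable hπ hS H).1
    have hsub : vDD π S H ⊆ S := filter_subset _ _
    have hTcard : (S \ vDD π S H).card = 2 * N - 2 * d := by
      rw [card_sdiff_of_subset hsub, hN, ← two_mul_card_reps hπ hπ' hC, hd]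
    have h0 : shellCount π (S \ vDD π S H) H (2 * f + h) h y = 0 := by
      unfold shellCount
      rw [Nat.cast_eq_zero, card_eq_zero, filter_eq_empty_iff]
      intro U hU _
      have := add_le_of_mem_shellIn hπ hT hU
      omega
    rw [h0]
    simp

/-- **(LP) in `descPochhammer` currency**: the same identity with every falling factorial written as the
evaluation of the polynomial `descPochhammer ℝ j` — at fixed `t = 2s + c` the right-hand side is visibly the
value at `c` of one real polynomial of degree `≤ N − d = a + b` (substitute `s = (t − c)/2`).
[cite: Rothvoss2017, §2 (PDF p. 6)] -/
theorem shellLaw_eq_sum_touch_descPochhammer {S : Finset (Fin n)} (hS : ∀ v ∈ S, π v ∈ S) {N : ℕ}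
    (hN : S.card = 2 * N) (H : Finset (Fin n)) {d : ℕ} (hd : (reps π (vDD π S H)).card = d) (s c : ℕ)
    (hsc : s + c ≤ N) (y : ℤ) :
    shellLaw π S H (2 * s + c) c y =
      ∑ f ∈ range (s + 1), ∑ h ∈ range (c + 1),
        shellCount π (S \ vDD π S H) H (2 * f + h) h y / 2 ^ h *
          ((descPochhammer ℝ f).eval (s : ℝ) * (descPochhammer ℝ h).eval (c : ℝ) *
            (descPochhammer ℝ (N - d - f - h)).eval ((N - s - c : ℕ) : ℝ)) /
            (descPochhammer ℝ (N - d)).eval (N : ℝ) := by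
  rw [shellLaw_eq_sum_touch_descFactorial hπ hπ' hS hN H hd s c hsc y]
  simp only [descPochhammer_eval_eq_descFactorial, Nat.cast_mul]

/-! ### §9 (K0-law) The `HH`-class split in LAW form, indexed by the pattern `(f, g)`

Write `AA = vAA_S(H)` for the `HH` class of the block (`a` edges) and classify a cut `U ∈ Shell_S(2s+c, c)` by the
numbers `f` and `g` of FULL and HALF `HH` edges it contains: they contribute `2f + g` to `|U ∩ H|`, the rest of
`U` is a cut of `S ∖ AA` (type `(0, b, d)`) with `s − f` full and `c − g` half edges. COUNT FORM
`Sh_S(2s+c, c; y) = Σ_{f ≤ s} Σ_{g ≤ c} C(a,f)·C(a−f,g)·2^g · Sh_{S∖AA}(2(s−f)+(c−g), c−g; y−(2f+g))`, and after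
division by the shell sizes (`card_shellIn_eq_choose` twice and the bookkeeping of §8) the LAW FORM
`law_S(2s+c, c; y) = Σ_{f ≤ a} Σ_{g ≤ a−f} C(a,f)C(a−f,g)·(s)_f (c)_g (N−s−c)_{a−f−g}/(N)_a · law_{S∖AA}(2(s−f)+(c−g), c−g; y−(2f+g))`
— the weights are the multivariate-hypergeometric probabilities that the `a` `HH` edges show `f` full, `g` half
and `a − f − g` empty edges under the uniform assignment of `(s, c, N−s−c)`; at fixed cut size `t = 2s + c` each is
a polynomial of degree `a` in the level `c`, vanishing at `c = 0` when `g ≥ 1` (eng g24's (K0-law) ask for brick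
T-K3; exact checks HOME pnp-psdrank-lit/num/g37/check_k0_law.py). -/

/-- For a cut `U` and a `π`-stable class `C`: `|U ∩ C| = 2·|reps(full(U) ∩ C)| + |half(U) ∩ C|` — inside `C` the
cut consists of whole edges and half vertices. [cite: Rothvoss2017, §2 (PDF p. 5)] -/
theorem card_inter_class_eq {U C : Finset (Fin n)} (hC : ∀ v ∈ C, π v ∈ C) :
    (U ∩ C).card = 2 * (reps π (full π U ∩ C)).card + (half π U ∩ C).card := by
  have hst : ∀ v ∈ full π U ∩ C, π v ∈ full π U ∩ C := by
    intro v hv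
    obtain ⟨hvF, hvC⟩ := mem_inter.1 hv
    obtain ⟨hvU, hπvU⟩ := mem_full.1 hvF
    exact mem_inter.2 ⟨mem_full.2 ⟨hπvU, by rw [hπ]; exact hvU⟩, hC v hvC⟩
  rw [two_mul_card_reps hπ hπ' hst]
  have hU : U ∩ C = (full π U ∩ C) ∪ (half π U ∩ C) := by
    ext v
    simp only [mem_inter, mem_union, mem_full, mem_half]
    tauto
  have hd : Disjoint (full π U ∩ C) (half π U ∩ C) := disjoint_left.2 fun v h1 h2 =>
    (mem_half.1 (mem_inter.1 h2).1).2 (mem_full.1 (mem_inter.1 h1).1).2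
  rw [hU, card_union_of_disjoint hd]

/-- **(K0), COUNT FORM in the pattern `(f, g)`.** For a `π`-stable `S`, a block `H` whose `HH` class
`AA = vAA_S(H)` has `a` edges, and all `s, c, y`:
`Sh_S(2s+c, c; y) = Σ_{f ≤ s} Σ_{g ≤ c} C(a,f)·C(a−f,g)·2^g · Sh_{S∖AA}(2(s−f)+(c−g), c−g; y − (2f+g))`
(`f` full and `g` half `HH` edges; `|Shell_{AA}(2f+g, g)| = C(a,f)C(a−f,g)2^g`).
[cite: Rothvoss2017, §2 (PDF p. 6)] -/
theorem shellCount_eq_sum_split_hh {S : Finset (Fin n)} (hS : ∀ v ∈ S, π v ∈ S) (H : Finset (Fin n))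
    {a : ℕ} (ha : (reps π (vAA π S H)).card = a) (s c : ℕ) (y : ℤ) :
    shellCount π S H (2 * s + c) c y =
      ∑ f ∈ range (s + 1), ∑ g ∈ range (c + 1),
        ((a.choose f * (a - f).choose g * 2 ^ g : ℕ) : ℝ) *
          shellCount π (S \ vAA π S H) H (2 * (s - f) + (c - g)) (c - g) (y - (2 * f + g)) := by
  classical
  set C := vAA π S H with hCdef
  have hC : ∀ v ∈ C, π v ∈ C := vAA_stable hπ S H hS
  have hCS : C ⊆ S := filter_subset _ _
  have hCH : ∀ v ∈ C, v ∈ H := fun v hv => (mem_vAA.1 hv).2.1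
  have hCcard : C.card = 2 * a := by rw [← ha, two_mul_card_reps hπ hπ' hC]
  unfold shellCount
  rw [card_eq_sum_card_fiberwise (f := fun U => ((reps π (full π U ∩ C)).card, (half π U ∩ C).card))
    (t := range (s + 1) ×ˢ range (c + 1)) (fun U hU => by
      simp only [mem_coe, mem_filter, mem_shellIn] at hU
      obtain ⟨⟨hUS, hUt, hUc⟩, _⟩ := hU
      simp only [mem_coe, mem_product, mem_range, Nat.lt_succ_iff]
      have hfull : ∀ v ∈ full π U, π v ∈ full π U := fun v hv => by
        obtain ⟨hvU, hπvU⟩ := mem_full.1 hv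
        exact mem_full.2 ⟨hπvU, by rw [hπ]; exact hvU⟩
      have h2 := two_mul_card_reps hπ hπ' hfull
      have h3 := card_full_add_card_half (π := π) U
      have h4 : (reps π (full π U ∩ C)).card ≤ (reps π (full π U)).card :=
        card_le_card (fun v hv => by
          rw [mem_reps] at hv ⊢
          exact ⟨(mem_inter.1 hv.1).1, hv.2⟩)
      have h5 : (half π U ∩ C).card ≤ (half π U).card := card_le_card inter_subset_left
      constructor <;> omega),
    sum_product]
  push_cast
  refine sum_congr rfl fun f hf => sum_congr rfl fun g hg => ?_
  have hf' : f ≤ s := Nat.lt_succ_iff.1 (mem_range.1 hf)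
  have hg' : g ≤ c := Nat.lt_succ_iff.1 (mem_range.1 hg)
  rw [filter_filter]
  have e : ((shellIn π S (2 * s + c) c).filter fun U => ((U ∩ H).card : ℤ) = y ∧
      ((reps π (full π U ∩ C)).card, (half π U ∩ C).card) = (f, g)) =
      (shellIn π S (2 * s + c) c).filter fun U => (U ∩ C).card = 2 * f + g ∧
        (half π U ∩ C).card = g ∧ (((U \ C) ∩ H).card : ℤ) = y - (2 * f + g) := by
    refine filter_congr fun U _ => ?_
    have hsplit : (U ∩ H).card = (U ∩ C).card + ((U \ C) ∩ H).card := by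
      have hd : Disjoint (U ∩ C) ((U \ C) ∩ H) :=
        disjoint_left.2 fun v hv hv' => (mem_sdiff.1 (mem_inter.1 hv').1).2 (mem_inter.1 hv).2
      rw [← card_union_of_disjoint hd]
      congr 1
      ext v
      simp only [mem_inter, mem_union, mem_sdiff]
      constructor
      · rintro ⟨hvU, hvH⟩
        by_cases hvC : v ∈ C
        · exact Or.inl ⟨hvU, hvC⟩
        · exact Or.inr ⟨⟨hvU, hvC⟩, hvH⟩
      · rintro (⟨hvU, hvC⟩ | ⟨⟨hvU, _⟩, hvH⟩)
        · exact ⟨hvU, hCH v hvC⟩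
        · exact ⟨hvU, hvH⟩
    have hcl := card_inter_class_eq hπ hπ' (U := U) hC
    simp only [Prod.mk.injEq]
    constructor
    · rintro ⟨hy, h1, h2⟩
      refine ⟨by omega, h2, ?_⟩
      rw [hsplit, hcl, h1, h2] at hy; push_cast at hy; linarith
    · rintro ⟨h1, h2, hy⟩
      refine ⟨?_, by omega, h2⟩
      rw [hsplit, hcl, h2]
      have h3 : (reps π (full π U ∩ C)).card = f := by omega
      rw [h3]; push_cast; linarith
  rw [e, card_shellIn_split_class hπ hC hCS (fun B => ((B ∩ H).card : ℤ) = y - (2 * f + g))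
    (by omega) hg']
  have e1 : 2 * s + c - (2 * f + g) = 2 * (s - f) + (c - g) := by omega
  rw [e1, card_shellIn_eq_choose hπ hπ' hC hCcard f g]
  push_cast
  ring

omit hπ hπ' in
/-- Extending the range of a sum whose summand vanishes from `m` on. [folklore] -/
private theorem sum_range_eq_sum_range_of_vanish {T : ℕ → ℝ} {m K : ℕ} (hmK : m ≤ K)
    (h : ∀ i, m ≤ i → T i = 0) : ∑ i ∈ range m, T i = ∑ i ∈ range K, T i :=
  sum_subset (fun i hi => mem_range.2 (lt_of_lt_of_le (mem_range.1 hi) hmK)) fun i _ hni => h i (by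
    simp only [mem_range, not_lt] at hni; exact hni)

/-- **(K0-law), LAW FORM in the pattern `(f, g)`, ranges `f ≤ s`, `g ≤ c`.** For a `π`-stable `S` with `N` edges,
a block `H` whose `HH` class `AA` has `a` edges, and `s + c ≤ N`:
`law_S(2s+c, c; y) = Σ_{f ≤ s} Σ_{g ≤ c} C(a,f)C(a−f,g)·(s)_f·(c)_g·(N−s−c)_{a−f−g}/(N)_a · law_{S∖AA}(2(s−f)+(c−g), c−g; y−(2f+g))`
(`(m)_j = Nat.descFactorial m j`; the weight is `C(a,f)C(a−f,g)·C(N−a,s−f)C(N−a−(s−f),c−g)/(C(N,s)C(N−s,c))`, the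
multivariate-hypergeometric probability that the `a` `HH` edges show `f` full and `g` half edges).
[cite: Rothvoss2017, §2 (PDF p. 6)] [cite: ChattamvelliShanmugam2020, §7.4 (PDF p. 144), multivariate
hypergeometric law] -/
theorem shellLaw_eq_sum_split_hh_descFactorial' {S : Finset (Fin n)} (hS : ∀ v ∈ S, π v ∈ S) {N : ℕ}
    (hN : S.card = 2 * N) (H : Finset (Fin n)) {a : ℕ} (ha : (reps π (vAA π S H)).card = a) (s c : ℕ)
    (hsc : s + c ≤ N) (y : ℤ) :
    shellLaw π S H (2 * s + c) c y =
      ∑ f ∈ range (s + 1), ∑ g ∈ range (c + 1),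
        ((a.choose f : ℝ) * ((a - f).choose g : ℝ) * (s.descFactorial f : ℝ) * (c.descFactorial g : ℝ) *
            ((N - s - c).descFactorial (a - f - g) : ℝ) / (N.descFactorial a : ℝ)) *
          shellLaw π (S \ vAA π S H) H (2 * (s - f) + (c - g)) (c - g) (y - (2 * f + g)) := by
  classical
  set C := vAA π S H with hCdef
  have hC : ∀ v ∈ C, π v ∈ C := vAA_stable hπ S H hS
  have hCS : C ⊆ S := filter_subset _ _
  have hCcard : C.card = 2 * a := by rw [← ha, two_mul_card_reps hπ hπ' hC]
  have haN : a ≤ N := by have := card_le_card hCS; omega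
  have hT : ∀ v ∈ S \ C, π v ∈ S \ C := (sdiff_vAA_noHH hπ hS H).1
  have hTcard : (S \ C).card = 2 * (N - a) := by
    rw [card_sdiff_of_subset hCS, hN, hCcard]; omega
  rw [shellLaw, shellCount_eq_sum_split_hh hπ hπ' hS H ha, card_shellIn_eq_choose hπ hπ' hS hN s c, sum_div]
  refine sum_congr rfl fun f hf => ?_
  rw [sum_div]
  refine sum_congr rfl fun g hg => ?_
  have hf' : f ≤ s := Nat.lt_succ_iff.1 (mem_range.1 hf)
  have hg' : g ≤ c := Nat.lt_succ_iff.1 (mem_range.1 hg)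
  rw [shellCount_eq_shellLaw_mul_card (π := π) (S \ C) H, card_shellIn_eq_choose hπ hπ' hT hTcard (s - f) (c - g)]
  set L := shellLaw π (S \ C) H (2 * (s - f) + (c - g)) (c - g) (y - (2 * f + g)) with hL
  have hD : ((N.choose s * (N - s).choose c * 2 ^ c : ℕ) : ℝ) ≠ 0 := by
    have h1 : 0 < N.choose s := Nat.choose_pos (by omega)
    have h2 : 0 < (N - s).choose c := Nat.choose_pos (by omega)
    positivity
  have hF : (N.descFactorial a : ℝ) ≠ 0 := by
    have := Nat.descFactorial_pos.2 haN
    exact_mod_cast this.ne'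
  by_cases hfg : f + g ≤ a
  · -- the honest case: the bookkeeping of §8 with `d = N − a`
    have hb := touch_bookkeeping N (N - a) s c f g (Nat.sub_le N a) hf' hg' hsc (by omega)
    have eNa : N - (N - a) = a := by omega
    rw [eNa] at hb
    have hb' := congrArg (fun m : ℕ => (m : ℝ)) hb
    have hD' : (N.choose s : ℝ) * ((N - s).choose c : ℝ) * 2 ^ c ≠ 0 := by push_cast at hD; exact hD
    push_cast at hb' ⊢
    rw [div_mul_eq_mul_div, div_eq_div_iff hD' hF]
    linear_combination ((a.choose f : ℝ) * ((a - f).choose g : ℝ) * L) * hb'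
  · -- `f + g > a`: a binomial coefficient vanishes on both sides
    push Not at hfg
    rcases le_or_gt f a with h1 | h1
    · rw [Nat.choose_eq_zero_of_lt (n := a - f) (by omega)]; simp
    · rw [Nat.choose_eq_zero_of_lt h1]; simp

/-- **(K0-law), LAW FORM in the pattern `(f, g)`, ranges `f ≤ a`, `g ≤ a − f`** (the index set of the patterns
of the `a` `HH` edges; terms with `f > s` or `g > c` vanish through `(s)_f = 0`, `(c)_g = 0`). For a `π`-stable `S`
with `N` edges, a block `H` whose `HH` class `AA = vAA_S(H)` has `a` edges, and `s + c ≤ N`: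
`law_S(2s+c, c; y) = Σ_{f ≤ a} Σ_{g ≤ a−f} C(a,f)·C(a−f,g)·(s)_f·(c)_g·(N−s−c)_{a−f−g}/(N)_a ·
law_{S∖AA}(2(s−f)+(c−g), c−g; y−(2f+g))`. At fixed cut size `t = 2s + c` the weight of `(f, g)` is a polynomial
of degree `a` in the level `c` (`(s)_f = Π_{i<f}((t−c)/2 − i)`, `(N−s−c)_{a−f−g} = Π_{i}(N − (t+c)/2 − i)`),
divisible by `c` when `g ≥ 1`. [cite: Rothvoss2017, §2 (PDF p. 6)] [cite: ChattamvelliShanmugam2020, §7.4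
(PDF p. 144), multivariate hypergeometric law] -/
theorem shellLaw_eq_sum_split_hh_descFactorial {S : Finset (Fin n)} (hS : ∀ v ∈ S, π v ∈ S) {N : ℕ}
    (hN : S.card = 2 * N) (H : Finset (Fin n)) {a : ℕ} (ha : (reps π (vAA π S H)).card = a) (s c : ℕ)
    (hsc : s + c ≤ N) (y : ℤ) :
    shellLaw π S H (2 * s + c) c y =
      ∑ f ∈ range (a + 1), ∑ g ∈ range (a - f + 1),
        ((a.choose f : ℝ) * ((a - f).choose g : ℝ) * (s.descFactorial f : ℝ) * (c.descFactorial g : ℝ) *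
            ((N - s - c).descFactorial (a - f - g) : ℝ) / (N.descFactorial a : ℝ)) *
          shellLaw π (S \ vAA π S H) H (2 * (s - f) + (c - g)) (c - g) (y - (2 * f + g)) := by
  rw [shellLaw_eq_sum_split_hh_descFactorial' hπ hπ' hS hN H ha s c hsc y]
  -- both double sums equal the sum over the square `range K × range K`, `K = a + s + c + 1`
  set T : ℕ → ℕ → ℝ := fun f g =>
    ((a.choose f : ℝ) * ((a - f).choose g : ℝ) * (s.descFactorial f : ℝ) * (c.descFactorial g : ℝ) *
        ((N - s - c).descFactorial (a - f - g) : ℝ) / (N.descFactorial a : ℝ)) *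
      shellLaw π (S \ vAA π S H) H (2 * (s - f) + (c - g)) (c - g) (y - (2 * f + g)) with hT
  have vf_s : ∀ f g, s < f → T f g = 0 := fun f g h => by
    simp only [hT, Nat.descFactorial_eq_zero_iff_lt.2 h, Nat.cast_zero, mul_zero, zero_mul, zero_div]
  have vg_c : ∀ f g, c < g → T f g = 0 := fun f g h => by
    simp only [hT, Nat.descFactorial_eq_zero_iff_lt.2 h, Nat.cast_zero, mul_zero, zero_mul, zero_div]
  have vf_a : ∀ f g, a < f → T f g = 0 := fun f g h => by
    simp only [hT, Nat.choose_eq_zero_of_lt h, Nat.cast_zero, zero_mul, zero_div]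
  have vg_a : ∀ f g, a - f < g → T f g = 0 := fun f g h => by
    simp only [hT, Nat.choose_eq_zero_of_lt h, Nat.cast_zero, mul_zero, zero_mul, zero_div]
  set K := a + s + c + 1 with hK
  show ∑ f ∈ range (s + 1), ∑ g ∈ range (c + 1), T f g = ∑ f ∈ range (a + 1), ∑ g ∈ range (a - f + 1), T f g
  have lhs : ∑ f ∈ range (s + 1), ∑ g ∈ range (c + 1), T f g = ∑ f ∈ range K, ∑ g ∈ range K, T f g := by
    rw [sum_range_eq_sum_range_of_vanish (K := K) (by omega) (fun f hf => by
      exact sum_eq_zero fun g _ => vf_s f g (by omega))]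
    exact sum_congr rfl fun f _ =>
      sum_range_eq_sum_range_of_vanish (K := K) (by omega) fun g hg => vg_c f g (by omega)
  have rhs : ∑ f ∈ range (a + 1), ∑ g ∈ range (a - f + 1), T f g = ∑ f ∈ range K, ∑ g ∈ range K, T f g := by
    rw [sum_range_eq_sum_range_of_vanish (K := K) (by omega) (fun f hf => by
      exact sum_eq_zero fun g _ => vf_a f g (by omega))]
    exact sum_congr rfl fun f _ =>
      sum_range_eq_sum_range_of_vanish (K := K) (by omega) fun g hg => vg_a f g (by omega)
  rw [lhs, rhs]

end Orientation

end ShellStep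

end Literature.Combinatorics.Optimization

end
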